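import Literature.Probability.RandomPlanarGeometry.SAWStripInsertionMargin
import Literature.Probability.RandomPlanarGeometry.SAWTubePolygons
import Mathlib.Order.LiminfLimsup
import Mathlib.Analysis.SpecialFunctions.Pow.Real
import Mathlib.Analysis.SpecialFunctions.Pow.Continuity
import Mathlib.Analysis.SpecificLimits.Normed
import HarnessLib

/-!
# Strict tube inequalities for the self-avoiding walk on `ℤ^d` with explicit margins
# (Madras–Slade Theorem 8.2.1, (8.2.11) and (8.2.13), for the tubes `ℤ × {0,…,L}^{d-1}`)

General-dimension version of `SAWStripInsertionMargin.lean` (lane pcv-sawmu, item X18): the column-insertion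
injection for the tubes `T_L = R[1,L] = ℤ × {0,…,L}^{d-1} ⊂ ℤ^d` (`Zd.InTube d 1 L`), `d ≥ 2`.  A cut is a
hyperplane `x₀ = c + ½` crossed by the walk; its strands are the crossing steps, with pairwise distinct
cross-sections; inserting two hyperplanes after every chosen cut, stretching all strands and letting the strand
of MAXIMAL LAST COORDINATE (ties: earliest) make an excursion to height `L + 1` in the last coordinate gives an
injection `(ω, R) ↦ Ψ(ω,R)` into the walks of `T_{L+1}` with cost `≤ κ = 2(L+1)^{d-1} + 2L + 2` per cut, and
every `n`-step walk of `T_L` has at least `n/(L+1)^{d-1}` cuts.  Consequences (the dimension is written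
`d + 2`, `d ≥ 0`):

* `TubeInsertion.log_tubeConnectiveConstant_succ_sub_log_ge` —
  `log(1 + μ(T_{L+1})^{-κ}) / (L+1)^{d-1} ≤ log μ(T_{L+1}) − log μ(T_L)` (quantitative (8.2.13), `k = 1`);
* `TubeInsertion.log_connectiveConstant_sub_log_tubeConnectiveConstant_ge` —
  `log(1 + μ(ℤ^d)^{-κ}) / (L+1)^{d-1} ≤ log μ(ℤ^d) − log μ(T_L)` (quantitative (8.2.11), `k = 1`);
* `TubeInsertion.tubeConnectiveConstant_lt_succ`, `…_lt_connectiveConstant`, `strictMono_…` — the printed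
  strict inequalities (8.2.13), (8.2.11) for `k = 1`, every `d ≥ 2`.

Everything except the seven cited public statements is `private` machinery (the planar file
`SAWStripInsertionMargin.lean` is the `d = 2` template; this file repeats its generic helpers because
private declarations cannot be imported).  Lane pcv-sawmu item X18; refute-first guards PREREG Am. H
(a-ref-2 / a-ref-1 / bench).

Tree twins: the planar case `d = 2` is `SAWStripInsertionMargin.lean` (same method; independently formalised in a
step-word model by the lane's seat a-p6 g2, HOME-staged `X16_StripInsert.lean`); the qualitative Theorem 8.2.1 for
every `k` by the printed renewal argument is the `SAWTubeRenewal.lean` line (a-p1 g2, (8.2.15)–(8.2.16)).  Note on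
the printed numbering: (8.2.11) `μ(R) < μ` is the remark preceding Theorem 8.2.1 (whose content is (8.2.12)–(8.2.13)).

Source of the printed statements: N. Madras, G. Slade, *The Self-Avoiding Walk* (1993), §8.2, Theorem 8.2.1,
book p. 269 (PDF p0281 of the 436-pp copy `book:madras1993-self-avoiding-walk` = p0210 of the 340-pp copy);
the proofs there (Pattern Theorem; renewal (8.2.15)–(8.2.16), book p. 270) give no margin.
-/

noncomputable section

open Filter Topology Literature.Probability.LatticeModels Literature.Probability.Percolation SimpleGraph
open scoped BigOperators

namespace Literature.Probability.RandomPlanarGeometry.SAW.Zd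

namespace TubeInsertion

variable {d : ℕ}

/-! ### Coordinates: the column `x₀` and the height `x_{d+1}` in `ℤ^{d+2}` -/

/-- The height coordinate (the last one). [folklore] -/
private def hI (d : ℕ) : Fin (d + 2) := Fin.last (d + 1)

/-- The height coordinate is not the column coordinate. [folklore] -/
private theorem hI_ne_zero (d : ℕ) : hI d ≠ 0 := by
  intro h; have := congrArg Fin.val h; simp [hI] at this

/-- The vector `a e₀`. [folklore] -/
private def cvec (d : ℕ) (a : ℤ) : Site (d + 2) := Pi.single 0 a

/-- The vector `b e_{d+1}`. [folklore] -/
private def hvec (d : ℕ) (b : ℤ) : Site (d + 2) := Pi.single (hI d) b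

/-- Column of `cvec`. [folklore] -/
@[simp] private theorem cvec_zero (a : ℤ) : cvec d a 0 = a := by simp [cvec]
/-- Other coordinates of `cvec`. [folklore] -/
@[simp] private theorem cvec_ne (a : ℤ) {i : Fin (d + 2)} (h : i ≠ 0) : cvec d a i = 0 := by simp [cvec, h]
/-- Height of `hvec`. [folklore] -/
@[simp] private theorem hvec_hI (b : ℤ) : hvec d b (hI d) = b := by simp [hvec]
/-- Other coordinates of `hvec`. [folklore] -/
@[simp] private theorem hvec_ne (b : ℤ) {i : Fin (d + 2)} (h : i ≠ hI d) : hvec d b i = 0 := by simp [hvec, h]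
/-- Column of `hvec`. [folklore] -/
@[simp] private theorem hvec_zero (b : ℤ) : hvec d b 0 = 0 := hvec_ne b (hI_ne_zero d).symm
/-- Height of `cvec`. [folklore] -/
@[simp] private theorem cvec_hI (a : ℤ) : cvec d a (hI d) = 0 := cvec_ne a (hI_ne_zero d)
/-- `cvec` is additive. [folklore] -/
private theorem cvec_add (a b : ℤ) : cvec d (a + b) = cvec d a + cvec d b := by simp [cvec, Pi.single_add]
/-- `hvec` is additive. [folklore] -/
private theorem hvec_add (a b : ℤ) : hvec d (a + b) = hvec d a + hvec d b := by simp [hvec, Pi.single_add]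

/-- Adjacency along `e₀`. [folklore] -/
private theorem adj_add_cvec_one (p : Site (d + 2)) : (zdGraph (d + 2)).Adj p (p + cvec d 1) := by
  rw [zdGraph_adj_iff]; exact ⟨0, Or.inl rfl⟩

/-- Adjacency along `e_{d+1}`. [folklore] -/
private theorem adj_add_hvec_one (p : Site (d + 2)) : (zdGraph (d + 2)).Adj p (p + hvec d 1) := by
  rw [zdGraph_adj_iff]; exact ⟨hI d, Or.inl rfl⟩

/-- Adjacency along `δ e₀`, `δ = ±1`. [folklore] -/
private theorem adj_add_cvec {δ : ℤ} (hδ : δ = 1 ∨ δ = -1) (p : Site (d + 2)) :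
    (zdGraph (d + 2)).Adj p (p + cvec d δ) := by
  rcases hδ with rfl | rfl
  · exact adj_add_cvec_one p
  · have : p = p + cvec d (-1) + cvec d 1 := by rw [add_assoc, ← cvec_add]; simp [cvec]
    rw [zdGraph_adj_iff]; exact ⟨0, Or.inr this⟩

/-- A step that changes the column is `± e₀` and keeps every other coordinate. [folklore] -/
private theorem step_of_col_ne {p q : Site (d + 2)} (h : (zdGraph (d + 2)).Adj p q) (hne : p 0 ≠ q 0) :
    (q = p + cvec d 1 ∨ q = p + cvec d (-1)) ∧ ∀ i : Fin (d + 2), i ≠ 0 → q i = p i := by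
  rw [zdGraph_adj_iff] at h
  obtain ⟨i, hi⟩ := h
  by_cases hi0 : i = 0
  · subst hi0
    rcases hi with h | h
    · refine ⟨Or.inl h, fun j hj => ?_⟩
      rw [h]; simp [hj]
    · have hq : q = p + cvec d (-1) := by
        rw [h, add_assoc, show (Pi.single 0 1 : Site (d + 2)) = cvec d 1 from rfl, ← cvec_add]; simp [cvec]
      refine ⟨Or.inr hq, fun j hj => ?_⟩
      rw [hq]; simp [hj]
  · exfalso; apply hne
    rcases hi with h | h
    · rw [h]; simp [Ne.symm hi0]
    · rw [h]; simp [Ne.symm hi0]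

/-! ### The column map `σ_R` -/

/-- The column map of the insertion at the cuts `R`: `σ_R(0) = 0` and
`σ_R(x+1) − σ_R(x) = 3` if `x ∈ R` (two columns inserted after column `x`), `= 1` otherwise.
[folklore] -/
private def colMap (R : Finset ℤ) (x : ℤ) : ℤ :=
  x + 2 * ∑ c ∈ R, ((if c < x then (1 : ℤ) else 0) - (if c < 0 then (1 : ℤ) else 0))

/-- `σ_R(0) = 0`. [folklore] -/
private theorem colMap_zero (R : Finset ℤ) : colMap R 0 = 0 := by
  simp [colMap]

/-- The increment of `σ_R`: `σ_R(x+1) = σ_R(x) + 1 + 2·[x ∈ R]`. [folklore] -/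
private theorem colMap_succ (R : Finset ℤ) (x : ℤ) :
    colMap R (x + 1) = colMap R x + 1 + 2 * (if x ∈ R then 1 else 0) := by
  have key : ∀ c : ℤ, ((if c < x + 1 then (1 : ℤ) else 0) - (if c < 0 then (1 : ℤ) else 0)) =
      ((if c < x then (1 : ℤ) else 0) - (if c < 0 then (1 : ℤ) else 0)) + (if c = x then 1 else 0) := by
    intro c
    split_ifs <;> omega
  simp only [colMap]
  rw [Finset.sum_congr rfl fun c _ => key c, Finset.sum_add_distrib, Finset.sum_ite_eq']
  ring

/-- `σ_R(x+1) = σ_R(x) + 3` for `x ∈ R`. [folklore] -/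
private theorem colMap_succ_of_mem {R : Finset ℤ} {x : ℤ} (hx : x ∈ R) : colMap R (x + 1) = colMap R x + 3 := by
  rw [colMap_succ, if_pos hx]; ring

/-- `σ_R(x+1) = σ_R(x) + 1` for `x ∉ R`. [folklore] -/
private theorem colMap_succ_of_not_mem {R : Finset ℤ} {x : ℤ} (hx : x ∉ R) :
    colMap R (x + 1) = colMap R x + 1 := by
  rw [colMap_succ, if_neg hx]; ring

/-- `σ_R` increases at every step. [folklore] -/
private theorem colMap_lt_succ (R : Finset ℤ) (x : ℤ) : colMap R x < colMap R (x + 1) := by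
  rw [colMap_succ]; split_ifs <;> omega

/-- `σ_R` is strictly increasing. [folklore] -/
private theorem colMap_strictMono (R : Finset ℤ) : StrictMono (colMap R) :=
  strictMono_int_of_lt_succ (colMap_lt_succ R)

/-- `σ_R` is injective. [folklore] -/
private theorem colMap_injective (R : Finset ℤ) : Function.Injective (colMap R) :=
  (colMap_strictMono R).injective

/-- `σ_R` reflects and preserves `<`. [folklore] -/
private theorem colMap_lt_iff (R : Finset ℤ) {x y : ℤ} : colMap R x < colMap R y ↔ x < y :=
  (colMap_strictMono R).lt_iff_lt

/-- `σ_R` reflects and preserves `≤`. [folklore] -/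
private theorem colMap_le_iff (R : Finset ℤ) {x y : ℤ} : colMap R x ≤ colMap R y ↔ x ≤ y :=
  (colMap_strictMono R).le_iff_le

/-- The two inserted columns `σ c + 1`, `σ c + 2` after a cut `c ∈ R` are not in the range of `σ`.
[folklore] -/
private theorem colMap_ne_ins {R : Finset ℤ} {c : ℤ} (hc : c ∈ R) (x : ℤ) {j : ℤ} (hj1 : 1 ≤ j) (hj2 : j ≤ 2) :
    colMap R x ≠ colMap R c + j := by
  intro h
  rcases le_or_gt x c with hxc | hxc
  · have := (colMap_le_iff R).2 hxc
    omega
  · have h1 : c + 1 ≤ x := hxc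
    have := (colMap_le_iff R).2 h1
    rw [colMap_succ_of_mem hc] at this
    omega

/-- Inserted columns of distinct cuts are distinct. [folklore] -/
private theorem ins_ne_ins {R : Finset ℤ} {c c' : ℤ} (hc : c ∈ R) (hc' : c' ∈ R) (hcc : c ≠ c')
    {j j' : ℤ} (hj1 : 1 ≤ j) (hj2 : j ≤ 2) (hj1' : 1 ≤ j') (hj2' : j' ≤ 2) :
    colMap R c + j ≠ colMap R c' + j' := by
  intro h
  rcases lt_or_gt_of_ne hcc with hlt | hlt
  · have h1 : c + 1 ≤ c' := hlt
    have := (colMap_le_iff R).2 h1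
    rw [colMap_succ_of_mem hc] at this
    omega
  · have h1 : c' + 1 ≤ c := hlt
    have := (colMap_le_iff R).2 h1
    rw [colMap_succ_of_mem hc'] at this
    omega

/-- The induced map on sites (column moved, all other coordinates kept). [folklore] -/
private def smap (R : Finset ℤ) (p : Site (d + 2)) : Site (d + 2) := Function.update p 0 (colMap R (p 0))

/-- The column of `smap R p`. [folklore] -/
@[simp] private theorem smap_zero (R : Finset ℤ) (p : Site (d + 2)) : smap R p 0 = colMap R (p 0) := by
  simp [smap]

/-- The other coordinates of `smap R p`. [folklore] -/
@[simp] private theorem smap_ne (R : Finset ℤ) (p : Site (d + 2)) {i : Fin (d + 2)} (h : i ≠ 0) :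
    smap R p i = p i := by
  simp [smap, h]

/-- `smap R` is injective. [folklore] -/
private theorem smap_injective (R : Finset ℤ) : Function.Injective (smap (d := d) R) := by
  intro p q h
  funext i
  by_cases hi : i = 0
  · subst hi
    have := congrFun h 0
    simp only [smap_zero] at this
    exact colMap_injective R this
  · have := congrFun h i
    simpa [hi] using this


/-! ### Crossing steps, cuts, strands, the marker strand -/

variable (ω : ℕ → Site (d + 2)) (n : ℕ)

/-- Step `t` of `ω` crosses the cut between the columns `c` and `c+1`. [folklore] -/
private def Crosses (t : ℕ) (c : ℤ) : Prop :=
  (ω t 0 = c ∧ ω (t + 1) 0 = c + 1) ∨ (ω t 0 = c + 1 ∧ ω (t + 1) 0 = c)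

/-- `Crosses` is decidable. [folklore] -/
private instance (t : ℕ) (c : ℤ) : Decidable (Crosses ω t c) := by
  unfold Crosses; infer_instance

/-- The cut crossed by a horizontal step `t`. [folklore] -/
private def cutOf (t : ℕ) : ℤ := min (ω t 0) (ω (t + 1) 0)

/-- The times `< n` at which `ω` crosses the cut `c` (the strands of `c`). [folklore] -/
private def crossTimes (c : ℤ) : Finset ℕ := (Finset.range n).filter fun t => Crosses ω t c

/-- The cuts crossed by the first `n` steps of `ω`. [folklore] -/
private def cuts : Finset ℤ :=
  ((Finset.range n).filter fun t => ω t 0 ≠ ω (t + 1) 0).image (cutOf ω)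

/-- The marker strand of the cut `c`: maximal height, and earliest among those. [folklore] -/
private def IsTop (c : ℤ) (t : ℕ) : Prop :=
  (∀ t' ∈ crossTimes ω n c, ω t' (hI d) ≤ ω t (hI d)) ∧
    ∀ t' ∈ crossTimes ω n c, ω t' (hI d) = ω t (hI d) → t ≤ t'

/-- `IsTop` is decidable. [folklore] -/
private instance (c : ℤ) (t : ℕ) : Decidable (IsTop ω n c t) := by
  unfold IsTop; infer_instance

variable {ω n}

/-- Membership in `crossTimes`. [folklore] -/
private theorem mem_crossTimes {c : ℤ} {t : ℕ} : t ∈ crossTimes ω n c ↔ t < n ∧ Crosses ω t c := by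
  simp [crossTimes]

/-- A crossing step changes column. [folklore] -/
private theorem Crosses.ne {t : ℕ} {c : ℤ} (h : Crosses ω t c) : ω t 0 ≠ ω (t + 1) 0 := by
  rcases h with ⟨h1, h2⟩ | ⟨h1, h2⟩ <;> omega

/-- A crossing step of `c` has cut `c`. [folklore] -/
private theorem Crosses.cutOf_eq {t : ℕ} {c : ℤ} (h : Crosses ω t c) : cutOf ω t = c := by
  unfold cutOf
  rcases h with ⟨h1, h2⟩ | ⟨h1, h2⟩ <;> rw [h1, h2] <;> simp

/-- A nearest-neighbour step with different columns crosses its cut and keeps the other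
coordinates. [folklore] -/
private theorem crosses_cutOf_of_ne {t : ℕ} (hadj : (zdGraph (d + 2)).Adj (ω t) (ω (t + 1)))
    (hne : ω t 0 ≠ ω (t + 1) 0) :
    Crosses ω t (cutOf ω t) ∧ ∀ i : Fin (d + 2), i ≠ 0 → ω (t + 1) i = ω t i := by
  obtain ⟨h, hrest⟩ := step_of_col_ne hadj hne
  refine ⟨?_, hrest⟩
  rcases h with h | h
  · have h0 : ω (t + 1) 0 = ω t 0 + 1 := by rw [h]; simp
    left; refine ⟨?_, ?_⟩ <;> simp [cutOf, h0]
  · have h0 : ω (t + 1) 0 = ω t 0 - 1 := by rw [h]; simp; ring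
    right; refine ⟨?_, ?_⟩ <;> simp [cutOf, h0]

/-- Membership in `cuts`. [folklore] -/
private theorem mem_cuts {c : ℤ} : c ∈ cuts ω n ↔ ∃ t < n, ω t 0 ≠ ω (t + 1) 0 ∧ cutOf ω t = c := by
  simp [cuts, and_assoc]

/-- A cut of a nearest-neighbour walk has a strand. [folklore] -/
private theorem crossTimes_nonempty (hadj : ∀ t < n, (zdGraph (d + 2)).Adj (ω t) (ω (t + 1))) {c : ℤ}
    (hc : c ∈ cuts ω n) : (crossTimes ω n c).Nonempty := by
  obtain ⟨t, ht, hne, rfl⟩ := mem_cuts.1 hc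
  exact ⟨t, mem_crossTimes.2 ⟨ht, (crosses_cutOf_of_ne (hadj t ht) hne).1⟩⟩

/-- Every cut of a nearest-neighbour walk has a marker strand. [folklore] -/
private theorem exists_isTop (hadj : ∀ t < n, (zdGraph (d + 2)).Adj (ω t) (ω (t + 1))) {c : ℤ}
    (hc : c ∈ cuts ω n) : ∃ t ∈ crossTimes ω n c, IsTop ω n c t := by
  obtain ⟨t₀, ht₀, hmax⟩ := Finset.exists_max_image _ (fun t => ω t (hI d)) (crossTimes_nonempty hadj hc)
  set S := (crossTimes ω n c).filter fun t => ω t (hI d) = ω t₀ (hI d) with hS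
  have hSne : S.Nonempty := ⟨t₀, Finset.mem_filter.2 ⟨ht₀, rfl⟩⟩
  obtain ⟨t, ht, hmin⟩ := Finset.exists_min_image S id hSne
  obtain ⟨htX, hth⟩ := Finset.mem_filter.1 ht
  refine ⟨t, htX, fun t' ht' => by rw [hth]; exact hmax t' ht', fun t' ht' h => ?_⟩
  exact hmin t' (Finset.mem_filter.2 ⟨ht', by rw [h, hth]⟩)

/-- The marker strand is unique. [folklore] -/
private theorem isTop_unique {c : ℤ} {t t' : ℕ} (ht : t ∈ crossTimes ω n c) (ht' : t' ∈ crossTimes ω n c)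
    (h : IsTop ω n c t) (h' : IsTop ω n c t') : t = t' := by
  have e : ω t (hI d) = ω t' (hI d) := le_antisymm (h'.1 t ht) (h.1 t' ht')
  exact le_antisymm (h.2 t' ht' e.symm) (h'.2 t ht e)

/-- Two strands of one cut with the same cross-section are the same step (self-avoidance).
[folklore] -/
private theorem crossTimes_pos_inj (hinj : Set.InjOn ω {i | i ≤ n})
    (hrest : ∀ t < n, ω t 0 ≠ ω (t + 1) 0 → ∀ i : Fin (d + 2), i ≠ 0 → ω (t + 1) i = ω t i)
    {c : ℤ} {t t' : ℕ} (ht : t ∈ crossTimes ω n c) (ht' : t' ∈ crossTimes ω n c)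
    (h : ∀ i : Fin (d + 2), i ≠ 0 → ω t i = ω t' i) : t = t' := by
  obtain ⟨htn, htc⟩ := mem_crossTimes.1 ht
  obtain ⟨htn', htc'⟩ := mem_crossTimes.1 ht'
  have hr := hrest t htn htc.ne
  have hr' := hrest t' htn' htc'.ne
  have key : ∀ {s s' : ℕ}, s ≤ n → s' ≤ n → ω s 0 = ω s' 0 →
      (∀ i : Fin (d + 2), i ≠ 0 → ω s i = ω s' i) → s = s' := by
    intro s s' hs hs' h0 hi
    refine hinj hs hs' (funext fun i => ?_)
    by_cases hi0 : i = 0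
    · subst hi0; exact h0
    · exact hi i hi0
  rcases htc with ⟨a1, a2⟩ | ⟨a1, a2⟩ <;> rcases htc' with ⟨b1, b2⟩ | ⟨b1, b2⟩
  · exact key (by omega) (by omega) (by rw [a1, b1]) h
  · have e1 : t = t' + 1 := key (by omega) (by omega) (by rw [a1, b2]) fun i hi => by rw [hr' i hi, h i hi]
    have e2 : t + 1 = t' := key (by omega) (by omega) (by rw [a2, b1]) fun i hi => by rw [hr i hi, h i hi]
    omega
  · have e1 : t = t' + 1 := key (by omega) (by omega) (by rw [a1, b2]) fun i hi => by rw [hr' i hi, h i hi]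
    have e2 : t + 1 = t' := key (by omega) (by omega) (by rw [a2, b1]) fun i hi => by rw [hr i hi, h i hi]
    omega
  · exact key (by omega) (by omega) (by rw [a1, b1]) h

/-! ### The blocks and the image list -/

/-- The excursion block of the marker strand: from the anchor `p`, one step to column `p₀ + δ`,
up in the last coordinate by `0, …, J`, over to column `p₀ + 2δ`, and down again. [folklore] -/
private def excursion (p : Site (d + 2)) (δ : ℤ) (J : ℕ) : List (Site (d + 2)) :=
  p :: (((List.range (J + 1)).map fun j : ℕ => p + cvec d δ + hvec d (j : ℤ)) ++
    ((List.range (J + 1)).map fun j : ℕ => p + cvec d (2 * δ) + hvec d (j : ℤ)).reverse)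

/-- The block of image points replacing the step `t` (not including the next anchor). [folklore] -/
private def block (L : ℕ) (R : Finset ℤ) (ω : ℕ → Site (d + 2)) (n t : ℕ) : List (Site (d + 2)) :=
  if ω t 0 ≠ ω (t + 1) 0 ∧ cutOf ω t ∈ R then
    if IsTop ω n (cutOf ω t) t then
      excursion (smap R (ω t)) (ω (t + 1) 0 - ω t 0) (L + 1 - (ω t (hI d)).toNat)
    else
      [smap R (ω t), smap R (ω t) + cvec d (ω (t + 1) 0 - ω t 0),
        smap R (ω t) + cvec d (2 * (ω (t + 1) 0 - ω t 0))]
  else [smap R (ω t)]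

/-- The image list `Ψ(ω, R)`. [folklore] -/
private def imageList (L : ℕ) (R : Finset ℤ) (ω : ℕ → Site (d + 2)) (n : ℕ) : List (Site (d + 2)) :=
  (List.range n).flatMap (block L R ω n) ++ [smap R (ω n)]

/-- The extra length of the block of a strand of `c`. [folklore] -/
private def extra (L : ℕ) (ω : ℕ → Site (d + 2)) (n : ℕ) (c : ℤ) (t : ℕ) : ℕ :=
  if IsTop ω n c t then 2 + 2 * (L + 1 - (ω t (hI d)).toNat) else 2

/-- The cost of the cut `c`. [folklore] -/
private def cost (L : ℕ) (ω : ℕ → Site (d + 2)) (n : ℕ) (c : ℤ) : ℕ :=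
  ∑ t ∈ crossTimes ω n c, extra L ω n c t

/-- The excursion block has `2J + 3` points. [folklore] -/
private theorem length_excursion (p : Site (d + 2)) (δ : ℤ) (J : ℕ) : (excursion p δ J).length = 2 * J + 3 := by
  simp [excursion]; ring

/-- Blocks are non-empty. [folklore] -/
private theorem block_ne_nil (L : ℕ) (R : Finset ℤ) (ω : ℕ → Site (d + 2)) (n t : ℕ) :
    block L R ω n t ≠ [] := by
  unfold block excursion; split_ifs <;> simp

/-- Every block starts with the anchor. [folklore] -/
private theorem head?_block (L : ℕ) (R : Finset ℤ) (ω : ℕ → Site (d + 2)) (n t : ℕ) :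
    (block L R ω n t).head? = some (smap R (ω t)) := by
  unfold block excursion
  split_ifs <;> simp

/-! ### Tube walks -/

/-- The standing hypotheses: `ω` is an `n`-step self-avoiding nearest-neighbour walk of the tube
`ℤ × {0,…,L}^{d+1}`. [folklore] -/
private structure TubeWalk (L : ℕ) (ω : ℕ → Site (d + 2)) (n : ℕ) : Prop where
  adj : ∀ t < n, (zdGraph (d + 2)).Adj (ω t) (ω (t + 1))
  inj : Set.InjOn ω {i | i ≤ n}
  box : ∀ t ≤ n, ∀ i : Fin (d + 2), i ≠ 0 → 0 ≤ ω t i ∧ ω t i ≤ (L : ℤ)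

variable {L : ℕ} {R : Finset ℤ}

/-- Horizontal steps keep the cross-section. [folklore] -/
private theorem TubeWalk.rest (hW : TubeWalk L ω n) :
    ∀ t < n, ω t 0 ≠ ω (t + 1) 0 → ∀ i : Fin (d + 2), i ≠ 0 → ω (t + 1) i = ω t i :=
  fun t ht hne => (crosses_cutOf_of_ne (hW.adj t ht) hne).2

/-- The geometry of a strand of a cut `c ∈ R`: direction `δ = ±1`, inserted columns
`σ(ω t 0) + δ, σ(ω t 0) + 2δ` (`= σ c + 1, σ c + 2` in some order), next anchor column `σ(ω t 0) + 3δ`.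
[folklore] -/
private theorem crossing_geometry (hW : TubeWalk L ω n) {t : ℕ} (ht : t < n) (hne : ω t 0 ≠ ω (t + 1) 0)
    (hR : cutOf ω t ∈ R) :
    ((colMap R (ω t 0) + (ω (t + 1) 0 - ω t 0) = colMap R (cutOf ω t) + 1 ∧
        colMap R (ω t 0) + 2 * (ω (t + 1) 0 - ω t 0) = colMap R (cutOf ω t) + 2) ∨
      (colMap R (ω t 0) + (ω (t + 1) 0 - ω t 0) = colMap R (cutOf ω t) + 2 ∧
        colMap R (ω t 0) + 2 * (ω (t + 1) 0 - ω t 0) = colMap R (cutOf ω t) + 1)) ∧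
    colMap R (ω (t + 1) 0) = colMap R (ω t 0) + 3 * (ω (t + 1) 0 - ω t 0) ∧
    (ω (t + 1) 0 - ω t 0 = 1 ∨ ω (t + 1) 0 - ω t 0 = -1) := by
  have hc := (crosses_cutOf_of_ne (hW.adj t ht) hne).1
  have h3 := colMap_succ_of_mem hR
  rcases hc with ⟨h1, h2⟩ | ⟨h1, h2⟩
  · rw [h1, h2]
    refine ⟨Or.inl ⟨by ring, by ring⟩, by rw [h3]; ring, Or.inl (by ring)⟩
  · rw [h1, h2, h3]
    refine ⟨Or.inr ⟨by ring, by ring⟩, by ring, Or.inr (by ring)⟩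

/-- Where the points of an excursion block live. [folklore] -/
private theorem mem_excursion {p : Site (d + 2)} {δ : ℤ} {J : ℕ} {z : Site (d + 2)} (hz : z ∈ excursion p δ J) :
    z = p ∨ ((z 0 = p 0 + δ ∨ z 0 = p 0 + 2 * δ) ∧ (∀ i : Fin (d + 2), i ≠ 0 → i ≠ hI d → z i = p i) ∧
      p (hI d) ≤ z (hI d) ∧ z (hI d) ≤ p (hI d) + J) := by
  unfold excursion at hz
  rw [List.mem_cons, List.mem_append, List.mem_reverse, List.mem_map, List.mem_map] at hz
  rcases hz with rfl | ⟨j, hj, rfl⟩ | ⟨j, hj, rfl⟩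
  · exact Or.inl rfl
  · right; rw [List.mem_range] at hj
    exact ⟨Or.inl (by simp), fun i h0 h1 => by simp [h0, h1], by simp, by simp; omega⟩
  · right; rw [List.mem_range] at hj
    exact ⟨Or.inr (by simp), fun i h0 h1 => by simp [h0, h1], by simp, by simp; omega⟩

/-- Where the points of a block live: the anchor, or an inserted point of the cut `c = cutOf ω t ∈ R`
in one of the two inserted columns, with the cross-section of the strand except possibly a larger
last coordinate (marker strand only), at most `L + 1`. [folklore] -/
private theorem mem_block (hW : TubeWalk L ω n) {t : ℕ} (ht : t < n) {z : Site (d + 2)}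
    (hz : z ∈ block L R ω n t) :
    z = smap R (ω t) ∨
    (ω t 0 ≠ ω (t + 1) 0 ∧ cutOf ω t ∈ R ∧
      (z 0 = colMap R (cutOf ω t) + 1 ∨ z 0 = colMap R (cutOf ω t) + 2) ∧
      (∀ i : Fin (d + 2), i ≠ 0 → i ≠ hI d → z i = ω t i) ∧
      ω t (hI d) ≤ z (hI d) ∧ z (hI d) ≤ (L : ℤ) + 1 ∧ (¬ IsTop ω n (cutOf ω t) t → z (hI d) = ω t (hI d))) := by
  have hb := hW.box t ht.le (hI d) (hI_ne_zero d)
  unfold block at hz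
  split_ifs at hz with h1 h2
  · rcases mem_excursion hz with rfl | ⟨hcol, hmid, hr1, hr2⟩
    · exact Or.inl rfl
    · right
      obtain ⟨hg, -, -⟩ := crossing_geometry hW ht h1.1 h1.2
      simp only [smap_zero, smap_ne _ _ (hI_ne_zero d)] at hcol hr1 hr2
      refine ⟨h1.1, h1.2, ?_, fun i h0 h1' => by rw [hmid i h0 h1', smap_ne _ _ h0], hr1, ?_,
        fun h => absurd h2 h⟩
      · rcases hg with ⟨g1, g2⟩ | ⟨g1, g2⟩ <;> rcases hcol with hc | hc <;>
          simp only [hc, g1, g2, true_or, or_true]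
      · have : ((L + 1 - (ω t (hI d)).toNat : ℕ) : ℤ) = L + 1 - ω t (hI d) := by
          have := Int.toNat_of_nonneg hb.1; omega
        rw [this] at hr2; omega
  · simp only [List.mem_cons, List.not_mem_nil, or_false] at hz
    obtain ⟨hg, -, -⟩ := crossing_geometry hW ht h1.1 h1.2
    rcases hz with rfl | rfl | rfl
    · exact Or.inl rfl
    · right
      refine ⟨h1.1, h1.2, ?_, fun i h0 h1' => by simp [h0], by simp [hI_ne_zero],
        by simp [hI_ne_zero]; omega, fun _ => by simp [hI_ne_zero]⟩
      rcases hg with ⟨g1, -⟩ | ⟨g1, -⟩ <;> simp [g1]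
    · right
      refine ⟨h1.1, h1.2, ?_, fun i h0 h1' => by simp [h0], by simp [hI_ne_zero],
        by simp [hI_ne_zero]; omega, fun _ => by simp [hI_ne_zero]⟩
      rcases hg with ⟨-, g2⟩ | ⟨-, g2⟩ <;> simp [g2]
  · simp only [List.mem_singleton] at hz
    exact Or.inl hz

/-- All image points lie in the tube of height `L + 1`. [folklore] -/
private theorem box_mem_block (hW : TubeWalk L ω n) {t : ℕ} (ht : t < n) {z : Site (d + 2)}
    (hz : z ∈ block L R ω n t) : ∀ i : Fin (d + 2), i ≠ 0 → 0 ≤ z i ∧ z i ≤ (L : ℤ) + 1 := by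
  intro i hi
  have hb := hW.box t ht.le i hi
  rcases mem_block hW ht hz with rfl | ⟨-, -, -, hmid, h1, h2, -⟩
  · rw [smap_ne _ _ hi]; omega
  · by_cases hiH : i = hI d
    · subst hiH
      have := hW.box t ht.le (hI d) (hI_ne_zero d); omega
    · rw [hmid i hi hiH]; omega

/-- Each block is duplicate-free. [folklore] -/
private theorem nodup_block (hW : TubeWalk L ω n) {t : ℕ} (ht : t < n) : (block L R ω n t).Nodup := by
  unfold block
  split_ifs with h1 h2
  · obtain ⟨-, -, hd⟩ := crossing_geometry hW ht h1.1 h1.2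
    have hd0 : ω (t + 1) 0 - ω t 0 ≠ 0 := by rcases hd with h | h <;> omega
    unfold excursion
    rw [List.nodup_cons, List.nodup_append]
    refine ⟨?_, ?_, ?_, ?_⟩
    · intro hmem
      rw [List.mem_append, List.mem_reverse, List.mem_map, List.mem_map] at hmem
      rcases hmem with ⟨j, -, hj⟩ | ⟨j, -, hj⟩ <;> have := congrFun hj 0 <;> simp at this <;> omega
    · refine List.Nodup.map (fun i j hij => ?_) List.nodup_range
      have := congrFun hij (hI d); simp at this; omega
    · rw [List.nodup_reverse]
      refine List.Nodup.map (fun i j hij => ?_) List.nodup_range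
      have := congrFun hij (hI d); simp at this; omega
    · intro z hz z' hz' h
      rw [List.mem_map] at hz
      rw [List.mem_reverse, List.mem_map] at hz'
      obtain ⟨j, -, rfl⟩ := hz
      obtain ⟨j', -, rfl⟩ := hz'
      have := congrFun h 0; simp at this; omega
  · obtain ⟨-, -, hd⟩ := crossing_geometry hW ht h1.1 h1.2
    have hd0 : ω (t + 1) 0 - ω t 0 ≠ 0 := by rcases hd with h | h <;> omega
    refine List.nodup_cons.2 ⟨fun hmem => ?_, List.nodup_cons.2 ⟨fun hmem => ?_, List.nodup_singleton _⟩⟩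
    · rw [List.mem_cons, List.mem_singleton] at hmem
      rcases hmem with h | h
      · have := congrFun h 0; simp at this; omega
      · have := congrFun h 0; simp at this; omega
    · rw [List.mem_singleton] at hmem
      have := congrFun hmem 0; simp at this; omega
  · exact List.nodup_singleton _

/-- Distinct blocks are disjoint. [folklore] -/
private theorem disjoint_block (hW : TubeWalk L ω n) {t t' : ℕ} (ht : t < n) (ht' : t' < n) (htt : t ≠ t') :
    List.Disjoint (block L R ω n t) (block L R ω n t') := by
  intro z hz hz'
  rcases mem_block hW ht hz with rfl | ⟨hne, hR, hcol, hmid, hr1, hr2, hr3⟩ <;>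
    rcases mem_block hW ht' hz' with h | ⟨hne', hR', hcol', hmid', hr1', hr2', hr3'⟩
  · exact htt (hW.inj (by show t ≤ n; omega) (by show t' ≤ n; omega) (smap_injective R h))
  · rcases hcol' with h | h
    · exact colMap_ne_ins hR' (ω t 0) (j := 1) (by norm_num) (by norm_num) (by simpa using h)
    · exact colMap_ne_ins hR' (ω t 0) (j := 2) (by norm_num) (by norm_num) (by simpa using h)
  · rcases hcol with h' | h'
    · exact colMap_ne_ins hR (ω t' 0) (j := 1) (by norm_num) (by norm_num) (by rw [← h', h]; simp)
    · exact colMap_ne_ins hR (ω t' 0) (j := 2) (by norm_num) (by norm_num) (by rw [← h', h]; simp)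
  · by_cases hcc : cutOf ω t = cutOf ω t'
    · have hx : t ∈ crossTimes ω n (cutOf ω t) :=
        mem_crossTimes.2 ⟨ht, (crosses_cutOf_of_ne (hW.adj t ht) hne).1⟩
      have hx' : t' ∈ crossTimes ω n (cutOf ω t) := by
        rw [hcc]; exact mem_crossTimes.2 ⟨ht', (crosses_cutOf_of_ne (hW.adj t' ht') hne').1⟩
      -- the two strands have different cross-sections
      have hpos : ¬ ∀ i : Fin (d + 2), i ≠ 0 → ω t i = ω t' i :=
        fun h => htt (crossTimes_pos_inj hW.inj hW.rest hx hx' h)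
      by_cases hsame : ∀ i : Fin (d + 2), i ≠ 0 → i ≠ hI d → ω t i = ω t' i
      · -- they differ in the last coordinate
        have hhh : ω t (hI d) ≠ ω t' (hI d) := by
          intro h; apply hpos; intro i hi
          by_cases hiH : i = hI d
          · subst hiH; exact h
          · exact hsame i hi hiH
        by_cases hT : IsTop ω n (cutOf ω t) t
        · have h1 := hT.1 t' hx'
          by_cases hT' : IsTop ω n (cutOf ω t') t'
          · have h2 := hT'.1 t (by rw [← hcc]; exact hx)
            omega
          · have := hr3' hT'; omega
        · have h1 := hr3 hT
          by_cases hT' : IsTop ω n (cutOf ω t') t'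
          · have h2 := hT'.1 t (by rw [← hcc]; exact hx)
            omega
          · have := hr3' hT'; omega
      · push Not at hsame
        obtain ⟨i, hi0, hiH, hne_i⟩ := hsame
        exact hne_i (by rw [← hmid i hi0 hiH, hmid' i hi0 hiH])
    · rcases hcol with h | h <;> rcases hcol' with h' | h'
      · exact ins_ne_ins hR hR' hcc (j := 1) (j' := 1) (by norm_num) (by norm_num) (by norm_num)
          (by norm_num) (by rw [← h, h'])
      · exact ins_ne_ins hR hR' hcc (j := 1) (j' := 2) (by norm_num) (by norm_num) (by norm_num)
          (by norm_num) (by rw [← h, h'])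
      · exact ins_ne_ins hR hR' hcc (j := 2) (j' := 1) (by norm_num) (by norm_num) (by norm_num)
          (by norm_num) (by rw [← h, h'])
      · exact ins_ne_ins hR hR' hcc (j := 2) (j' := 2) (by norm_num) (by norm_num) (by norm_num)
          (by norm_num) (by rw [← h, h'])

/-- The final anchor is in no block. [folklore] -/
private theorem last_not_mem_block (hW : TubeWalk L ω n) {t : ℕ} (ht : t < n) :
    smap R (ω n) ∉ block L R ω n t := by
  intro hz
  rcases mem_block hW ht hz with h | ⟨-, hR, hcol, -⟩
  · have := hW.inj (by show n ≤ n; omega) (by show t ≤ n; omega) (smap_injective R h)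
    omega
  · rcases hcol with h | h
    · exact colMap_ne_ins hR (ω n 0) (j := 1) (by norm_num) (by norm_num) (by simpa using h)
    · exact colMap_ne_ins hR (ω n 0) (j := 2) (by norm_num) (by norm_num) (by simpa using h)

/-- **The image list has no repeated point.** [folklore] -/
private theorem nodup_imageList (hW : TubeWalk L ω n) (R : Finset ℤ) : (imageList L R ω n).Nodup := by
  rw [imageList, List.nodup_append]
  refine ⟨?_, List.nodup_singleton _, ?_⟩
  · rw [List.nodup_flatMap]
    refine ⟨fun t ht => nodup_block hW (List.mem_range.1 ht), ?_⟩
    exact List.pairwise_lt_range.imp_of_mem fun {t t'} ht ht' hlt =>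
      disjoint_block hW (List.mem_range.1 ht) (List.mem_range.1 ht') hlt.ne
  · intro z hz z' hz' hzz
    rw [List.mem_singleton] at hz'
    subst hzz; subst hz'
    obtain ⟨t, ht, hzt⟩ := List.mem_flatMap.1 hz
    exact last_not_mem_block hW (List.mem_range.1 ht) hzt


/-! ### The image list is a nearest-neighbour chain -/

/-- A `map` over `range` is a chain when consecutive values are related. [folklore] -/
private theorem isChain_map_range {α : Type*} {S : α → α → Prop} (f : ℕ → α) (m : ℕ)
    (h : ∀ j, j + 1 < m → S (f j) (f (j + 1))) : ((List.range m).map f).IsChain S := by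
  rw [List.isChain_map]
  cases m with
  | zero => simp
  | succ m => exact (List.isChain_range_succ _ m).2 fun j hj => h j (by omega)

/-- The head of `(range (m+1)).map f`. [folklore] -/
private theorem head?_map_range_succ {α : Type*} (f : ℕ → α) (m : ℕ) :
    ((List.range (m + 1)).map f).head? = some (f 0) := by
  rw [List.range_succ_eq_map]; rfl

/-- The last element of `(range (m+1)).map f`. [folklore] -/
private theorem getLast?_map_range_succ {α : Type*} (f : ℕ → α) (m : ℕ) :
    ((List.range (m + 1)).map f).getLast? = some (f m) := by
  rw [List.range_succ, List.map_append, List.map_singleton, List.getLast?_append,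
    List.getLast?_singleton, Option.some_or]

/-- `hvec d 0 = 0`. [folklore] -/
@[simp] private theorem hvec_zero_eq : hvec d 0 = 0 := by simp [hvec]

/-- The excursion block is a nearest-neighbour chain. [folklore] -/
private theorem isChain_excursion {p : Site (d + 2)} {δ : ℤ} (hδ : δ = 1 ∨ δ = -1) (J : ℕ) :
    (excursion p δ J).IsChain (zdGraph (d + 2)).Adj := by
  unfold excursion
  rw [List.isChain_cons]
  refine ⟨?_, ?_⟩
  · intro y hy
    rw [List.head?_append, head?_map_range_succ, Option.some_or, Option.mem_def,
      Option.some.injEq] at hy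
    subst hy
    simpa using adj_add_cvec hδ p
  · refine List.IsChain.append ?_ ?_ ?_
    · exact isChain_map_range _ _ fun j _ => by
        push_cast; rw [hvec_add, ← add_assoc]; exact adj_add_hvec_one _
    · rw [← List.map_reverse, List.isChain_map, List.isChain_reverse,
        ← List.isChain_map (f := fun j : ℕ => p + cvec d (2 * δ) + hvec d (j : ℤ))
          (R := fun a b => (zdGraph (d + 2)).Adj b a)]
      exact isChain_map_range _ _ fun j _ => by
        show (zdGraph (d + 2)).Adj _ _
        push_cast; rw [hvec_add, ← add_assoc]; exact (adj_add_hvec_one _).symm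
    · intro a ha b hb
      rw [getLast?_map_range_succ, Option.mem_def, Option.some.injEq] at ha
      rw [← List.map_reverse, List.head?_map, List.head?_reverse, List.getLast?_range,
        Nat.add_sub_cancel] at hb
      simp only [Nat.add_eq_zero_iff, one_ne_zero, and_false, ↓reduceIte, Option.map_some,
        Option.mem_def, Option.some.injEq] at hb
      subst ha; subst hb
      have : p + cvec d (2 * δ) + hvec d (J : ℤ) = p + cvec d δ + hvec d (J : ℤ) + cvec d δ := by
        rw [two_mul, cvec_add]; abel
      rw [this]; exact adj_add_cvec hδ _

/-- The last point of the excursion block. [folklore] -/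
private theorem getLast?_excursion (p : Site (d + 2)) (δ : ℤ) (J : ℕ) :
    (excursion p δ J).getLast? = some (p + cvec d (2 * δ)) := by
  unfold excursion
  rw [List.getLast?_cons, List.getLast?_append, List.getLast?_reverse, head?_map_range_succ]
  simp

/-- The direction of a horizontal step is `±1`. [folklore] -/
private theorem crossing_geometry' (hW : TubeWalk L ω n) {t : ℕ} (ht : t < n) (hne : ω t 0 ≠ ω (t + 1) 0) :
    ω (t + 1) 0 - ω t 0 = 1 ∨ ω (t + 1) 0 - ω t 0 = -1 := by
  rcases (crosses_cutOf_of_ne (hW.adj t ht) hne).1 with ⟨h1, h2⟩ | ⟨h1, h2⟩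
  · left; omega
  · right; omega

/-- The next anchor after a strand of a cut of `R` is three columns further. [folklore] -/
private theorem smap_succ_of_mem (hW : TubeWalk L ω n) {t : ℕ} (ht : t < n) (hne : ω t 0 ≠ ω (t + 1) 0)
    (hR : cutOf ω t ∈ R) : smap R (ω (t + 1)) = smap R (ω t) + cvec d (3 * (ω (t + 1) 0 - ω t 0)) := by
  obtain ⟨-, h3, -⟩ := crossing_geometry hW ht hne hR
  funext i
  by_cases hi : i = 0
  · subst hi; simp [h3]
  · simp [hi, hW.rest t ht hne i hi]

/-- The next anchor after a horizontal step across a cut not in `R` is one column further. [folklore] -/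
private theorem smap_succ_of_not_mem (hW : TubeWalk L ω n) {t : ℕ} (ht : t < n) (hne : ω t 0 ≠ ω (t + 1) 0)
    (hR : cutOf ω t ∉ R) : smap R (ω (t + 1)) = smap R (ω t) + cvec d (ω (t + 1) 0 - ω t 0) := by
  have hc := (crosses_cutOf_of_ne (hW.adj t ht) hne).1
  have h1 := colMap_succ_of_not_mem hR
  funext i
  by_cases hi : i = 0
  · subst hi
    rcases hc with ⟨a1, a2⟩ | ⟨a1, a2⟩
    · simp [a1, a2, h1]
    · simp [a1, a2, h1]
  · simp [hi, hW.rest t ht hne i hi]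

/-- The anchors of a vertical step are adjacent. [folklore] -/
private theorem smap_adj_of_col_eq (hW : TubeWalk L ω n) {t : ℕ} (ht : t < n) (heq : ω t 0 = ω (t + 1) 0) :
    (zdGraph (d + 2)).Adj (smap R (ω t)) (smap R (ω (t + 1))) := by
  have hadj := hW.adj t ht
  rw [zdGraph_adj_iff] at hadj ⊢
  obtain ⟨i, hi⟩ := hadj
  have hi0 : i ≠ 0 := by
    rintro rfl
    rcases hi with h | h
    · have := congrFun h 0; simp at this; omega
    · have := congrFun h 0; simp at this; omega
  refine ⟨i, ?_⟩
  rcases hi with h | h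
  · left; funext j
    by_cases hj : j = 0
    · subst hj; simp [heq, Pi.single_eq_of_ne (Ne.symm hi0)]
    · have := congrFun h j; simp [hj] at this ⊢; exact this
  · right; funext j
    by_cases hj : j = 0
    · subst hj; simp [heq, Pi.single_eq_of_ne (Ne.symm hi0)]
    · have := congrFun h j; simp [hj] at this ⊢; exact this

/-- Each block is a nearest-neighbour chain. [folklore] -/
private theorem isChain_block (hW : TubeWalk L ω n) {t : ℕ} (ht : t < n) :
    (block L R ω n t).IsChain (zdGraph (d + 2)).Adj := by
  unfold block
  split_ifs with h1 h2
  · exact isChain_excursion (crossing_geometry hW ht h1.1 h1.2).2.2 _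
  · obtain ⟨-, -, hd⟩ := crossing_geometry hW ht h1.1 h1.2
    refine List.isChain_cons_cons.2 ⟨adj_add_cvec hd _, List.isChain_cons_cons.2 ⟨?_, List.isChain_singleton _⟩⟩
    rw [two_mul, cvec_add, ← add_assoc]; exact adj_add_cvec hd _
  · exact List.isChain_singleton _

/-- The last point of the block of step `t` is adjacent to the next anchor. [folklore] -/
private theorem getLast_block_adj (hW : TubeWalk L ω n) {t : ℕ} (ht : t < n) :
    ∀ z ∈ (block L R ω n t).getLast?, (zdGraph (d + 2)).Adj z (smap R (ω (t + 1))) := by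
  intro z hz
  unfold block at hz
  split_ifs at hz with h1 h2
  · obtain ⟨-, -, hd⟩ := crossing_geometry hW ht h1.1 h1.2
    rw [getLast?_excursion, Option.mem_def, Option.some.injEq] at hz
    subst hz
    rw [smap_succ_of_mem hW ht h1.1 h1.2, show (3 : ℤ) * _ = 2 * (ω (t + 1) 0 - ω t 0) + (ω (t + 1) 0 - ω t 0) by ring,
      cvec_add, ← add_assoc]
    exact adj_add_cvec hd _
  · obtain ⟨-, -, hd⟩ := crossing_geometry hW ht h1.1 h1.2
    simp only [List.getLast?_cons_cons, List.getLast?_singleton, Option.mem_def,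
      Option.some.injEq] at hz
    subst hz
    rw [smap_succ_of_mem hW ht h1.1 h1.2, show (3 : ℤ) * _ = 2 * (ω (t + 1) 0 - ω t 0) + (ω (t + 1) 0 - ω t 0) by ring,
      cvec_add, ← add_assoc]
    exact adj_add_cvec hd _
  · simp only [List.getLast?_singleton, Option.mem_def, Option.some.injEq] at hz
    subst hz
    by_cases hne : ω t 0 = ω (t + 1) 0
    · exact smap_adj_of_col_eq hW ht hne
    · have hR : cutOf ω t ∉ R := fun h => h1 ⟨hne, h⟩
      rw [smap_succ_of_not_mem hW ht hne hR]
      exact adj_add_cvec (crossing_geometry' hW ht hne) _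

/-- Gluing the blocks. [folklore] -/
private theorem isChain_flatMap_blocks (hW : TubeWalk L ω n) :
    ∀ m ≤ n, ((List.range m).flatMap (block L R ω n)).IsChain (zdGraph (d + 2)).Adj ∧
      ∀ z ∈ ((List.range m).flatMap (block L R ω n)).getLast?, (zdGraph (d + 2)).Adj z (smap R (ω m))
  | 0, _ => by simp
  | m + 1, hm => by
    obtain ⟨ih1, ih2⟩ := isChain_flatMap_blocks hW m (by omega)
    rw [List.range_succ, List.flatMap_append, List.flatMap_singleton]
    refine ⟨List.IsChain.append ih1 (isChain_block hW (by omega)) fun z hz y hy => ?_, ?_⟩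
    · rw [head?_block, Option.mem_def, Option.some.injEq] at hy
      subst hy
      exact ih2 z hz
    · intro z hz
      rw [List.getLast?_append] at hz
      obtain ⟨w, hw⟩ := List.getLast?_isSome.2 (block_ne_nil L R ω n m) |> Option.isSome_iff_exists.1
      rw [hw, Option.some_or, Option.mem_def, Option.some.injEq] at hz
      subst hz
      exact getLast_block_adj hW (by omega) w (by rw [hw]; rfl)

/-- **The image list is a nearest-neighbour chain.** [folklore] -/
private theorem isChain_imageList (hW : TubeWalk L ω n) (R : Finset ℤ) :
    (imageList L R ω n).IsChain (zdGraph (d + 2)).Adj := by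
  obtain ⟨h1, h2⟩ := isChain_flatMap_blocks (R := R) hW n le_rfl
  exact List.IsChain.append h1 (List.isChain_singleton _) fun z hz y hy => by
    rw [List.head?_cons, Option.mem_def, Option.some.injEq] at hy
    subst hy; exact h2 z hz

/-- The image list starts at the anchor `σ(ω 0)`. [folklore] -/
private theorem head?_imageList (R : Finset ℤ) (ω : ℕ → Site (d + 2)) (n : ℕ) :
    (imageList L R ω n).head? = some (smap R (ω 0)) := by
  unfold imageList
  cases n with
  | zero => simp
  | succ n =>
    rw [List.range_succ_eq_map, List.flatMap_cons, List.append_assoc, List.head?_append,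
      head?_block, Option.some_or]

/-- All points of the image list lie in the tube of height `L + 1`. [folklore] -/
private theorem box_mem_imageList (hW : TubeWalk L ω n) {z : Site (d + 2)} (hz : z ∈ imageList L R ω n) :
    ∀ i : Fin (d + 2), i ≠ 0 → 0 ≤ z i ∧ z i ≤ (L : ℤ) + 1 := by
  rw [imageList, List.mem_append, List.mem_flatMap, List.mem_singleton] at hz
  rcases hz with ⟨t, ht, hzt⟩ | rfl
  · exact box_mem_block hW (List.mem_range.1 ht) hzt
  · intro i hi
    rw [smap_ne _ _ hi]
    have := hW.box n le_rfl i hi; omega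

/-! ### From vertex lists to the vertex functions of `saws` -/

/-- The vertex function of a vertex list, frozen at the last vertex. [folklore] -/
private def ofList (l : List (Site (d + 2))) (s : ℕ) : Site (d + 2) := (l[s]?).getD (l.getLast?.getD 0)

/-- `ofList l s = l[s]` inside the list. [folklore] -/
private theorem ofList_eq_getElem {l : List (Site (d + 2))} {s : ℕ} (hs : s < l.length) : ofList l s = l[s] := by
  simp [ofList, List.getElem?_eq_getElem hs]

/-- `ofList l s` is the last vertex from the last index on. [folklore] -/
private theorem ofList_eq_getLast {l : List (Site (d + 2))} (hl : l ≠ []) {s : ℕ} (hs : l.length - 1 ≤ s) :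
    ofList l s = l.getLast hl := by
  rcases lt_or_ge s l.length with h | h
  · rw [ofList_eq_getElem h, List.getLast_eq_getElem]
    congr 1; omega
  · simp [ofList, List.getElem?_eq_none h, List.getLast?_eq_getLast_of_ne_nil hl]

/-- A duplicate-free nearest-neighbour vertex list, read as a vertex function translated to the
origin, is a walk of `saws`. [folklore] -/
private theorem ofList_sub_mem_saws {l : List (Site (d + 2))} (hl : l ≠ []) (hN : l.Nodup)
    (hC : l.IsChain (zdGraph (d + 2)).Adj) (p : Site (d + 2)) (hp : l.head? = some p) :
    (fun s => ofList l s - p) ∈ saws (d + 2) (l.length - 1) := by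
  have hlen : 0 < l.length := List.length_pos_of_ne_nil hl
  have hp' : l[0] = p := by
    rw [← List.head_eq_getElem hl]; exact Option.some.inj ((List.head?_eq_some_head hl).symm.trans hp)
  rw [mem_saws]
  refine ⟨?_, ?_, ?_, ?_⟩
  · show ofList l 0 - p = 0
    rw [ofList_eq_getElem hlen, hp', sub_self]
  · intro i hi
    show ofList l i - p = ofList l (l.length - 1) - p
    rw [ofList_eq_getLast hl hi, ofList_eq_getLast hl le_rfl]
  · intro i hi
    show (zdGraph (d + 2)).Adj (ofList l i - p) (ofList l (i + 1) - p)
    rw [zdGraph_adj_sub_right, ofList_eq_getElem (by omega), ofList_eq_getElem (by omega)]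
    exact List.isChain_iff_getElem.1 hC i (by omega)
  · intro i hi j hj hij
    simp only [Set.mem_setOf_eq] at hi hj
    have h' : ofList l i = ofList l j := sub_left_inj.1 hij
    rw [ofList_eq_getElem (by omega), ofList_eq_getElem (by omega)] at h'
    exact (hN.getElem_inj_iff).1 h'

/-- Two lists of the same length with the same vertex function are equal. [folklore] -/
private theorem ofList_inj {l l' : List (Site (d + 2))} (hlen : l.length = l'.length)
    (h : ∀ s, ofList l s = ofList l' s) : l = l' :=
  List.ext_getElem hlen fun i h1 h2 => by
    rw [← ofList_eq_getElem h1, ← ofList_eq_getElem h2, h i]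

/-- A vertex function belongs to at most one `saws d m`. [folklore] -/
private theorem eq_of_mem_saws_of_mem_saws {e m m' : ℕ} {υ : ℕ → Site e} (h : υ ∈ saws e m)
    (h' : υ ∈ saws e m') : m = m' := by
  obtain ⟨-, he, -, hi⟩ := mem_saws.1 h
  obtain ⟨-, he', -, hi'⟩ := mem_saws.1 h'
  by_contra hne
  rcases lt_or_gt_of_ne hne with hlt | hlt
  · have := hi' (show m ≤ m' by omega) (show m + 1 ≤ m' by omega) (he (m + 1) (by omega)).symm
    omega
  · have := hi (show m' ≤ m by omega) (show m' + 1 ≤ m by omega) (he' (m' + 1) (by omega)).symm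
    omega

/-! ### The image walk `Ψ(ω, R)` -/

/-- `Ψ(ω,R)` as a vertex function from the origin. [folklore] -/
private def psi (L : ℕ) (R : Finset ℤ) (ω : ℕ → Site (d + 2)) (n : ℕ) : ℕ → Site (d + 2) :=
  fun s => ofList (imageList L R ω n) s - ω 0

/-- The image list is non-empty. [folklore] -/
private theorem imageList_ne_nil (L : ℕ) (R : Finset ℤ) (ω : ℕ → Site (d + 2)) (n : ℕ) :
    imageList L R ω n ≠ [] := by
  simp [imageList]

/-- `smap R` fixes the sites of column `0`. [folklore] -/
private theorem smap_eq_self_of_col_zero (R : Finset ℤ) {p : Site (d + 2)} (hp : p 0 = 0) : smap R p = p := by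
  funext i
  by_cases hi : i = 0
  · subst hi; simp [hp, colMap_zero]
  · simp [hi]

/-- **`Ψ(ω,R)` is a self-avoiding walk** of length `|imageList| - 1` whose translate by `ω 0` stays in
the tube of height `L + 1`. [folklore] -/
private theorem psi_mem_tubeWalksFrom (hW : TubeWalk L ω n) (h0 : ω 0 0 = 0) (R : Finset ℤ) :
    psi L R ω n ∈ tubeWalksFrom (d + 2) 1 (L + 1) ((imageList L R ω n).length - 1) (ω 0) := by
  rw [mem_tubeWalksFrom]
  refine ⟨ofList_sub_mem_saws (imageList_ne_nil L R ω n) (nodup_imageList hW R)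
    (isChain_imageList hW R) (ω 0) (by rw [head?_imageList, smap_eq_self_of_col_zero R h0]), ?_⟩
  intro s _ i hi
  have hi0 : i ≠ 0 := by rintro rfl; simp at hi
  show 0 ≤ (ω 0 + (ofList (imageList L R ω n) s - ω 0)) i ∧
    (ω 0 + (ofList (imageList L R ω n) s - ω 0)) i ≤ ((L + 1 : ℕ) : ℤ)
  rw [add_sub_cancel]
  have hmem : ofList (imageList L R ω n) s ∈ imageList L R ω n := by
    rcases lt_or_ge s (imageList L R ω n).length with h | h
    · rw [ofList_eq_getElem h]; exact List.getElem_mem h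
    · rw [ofList_eq_getLast (imageList_ne_nil L R ω n) (by omega)]; exact List.getLast_mem _
  have := box_mem_imageList hW hmem i hi0
  push_cast
  exact this

/-! ### Length of the image and the cost of a cut -/

/-- The length of a block: `1 +` the extra length of a strand of a cut of `R`. [folklore] -/
private theorem length_block (L : ℕ) (R : Finset ℤ) (ω : ℕ → Site (d + 2)) (n t : ℕ) :
    (block L R ω n t).length =
      1 + if ω t 0 ≠ ω (t + 1) 0 ∧ cutOf ω t ∈ R then extra L ω n (cutOf ω t) t else 0 := by
  unfold block extra
  split_ifs <;> simp [length_excursion]; ring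

/-- The strands of `c` are the horizontal steps whose cut is `c`. [folklore] -/
private theorem crossTimes_eq_filter (hW : TubeWalk L ω n) (c : ℤ) :
    crossTimes ω n c = (Finset.range n).filter fun t => ω t 0 ≠ ω (t + 1) 0 ∧ cutOf ω t = c := by
  ext t
  rw [mem_crossTimes, Finset.mem_filter, Finset.mem_range]
  constructor
  · rintro ⟨ht, hc⟩
    exact ⟨ht, hc.ne, hc.cutOf_eq⟩
  · rintro ⟨ht, hne, rfl⟩
    exact ⟨ht, (crosses_cutOf_of_ne (hW.adj t ht) hne).1⟩

/-- A list sum over `range` is a `Finset` sum. [folklore] -/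
private theorem list_sum_map_range {M : Type*} [AddCommMonoid M] (f : ℕ → M) :
    ∀ n : ℕ, ((List.range n).map f).sum = ∑ t ∈ Finset.range n, f t
  | 0 => by simp
  | n + 1 => by
    rw [List.range_succ, List.map_append, List.sum_append, list_sum_map_range f n,
      Finset.sum_range_succ]
    simp

/-- **Length of the image**: `|Ψ(ω,R)| = n + Σ_{c ∈ R} cost(c)` steps. [folklore] -/
private theorem length_imageList (hW : TubeWalk L ω n) (R : Finset ℤ) :
    (imageList L R ω n).length = n + 1 + ∑ c ∈ R, cost L ω n c := by
  rw [imageList, List.length_append, List.length_singleton, List.length_flatMap,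
    list_sum_map_range]
  simp_rw [length_block]
  rw [Finset.sum_add_distrib, Finset.sum_const, Finset.card_range, smul_eq_mul, mul_one,
    ← Finset.sum_filter]
  have hmaps : ∀ t ∈ (Finset.range n).filter (fun t => ω t 0 ≠ ω (t + 1) 0 ∧ cutOf ω t ∈ R),
      cutOf ω t ∈ R := fun t ht => (Finset.mem_filter.1 ht).2.2
  rw [← Finset.sum_fiberwise_of_maps_to hmaps]
  have hinner : ∀ c ∈ R,
      ∑ t ∈ ((Finset.range n).filter (fun t => ω t 0 ≠ ω (t + 1) 0 ∧ cutOf ω t ∈ R)).filter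
          (fun t => cutOf ω t = c), extra L ω n (cutOf ω t) t = cost L ω n c := by
    intro c hc
    rw [cost, crossTimes_eq_filter hW c]
    refine Finset.sum_congr ?_ fun t ht => ?_
    · ext t
      simp only [Finset.mem_filter, Finset.mem_range]
      constructor
      · rintro ⟨⟨ht, hne, -⟩, rfl⟩; exact ⟨ht, hne, rfl⟩
      · rintro ⟨ht, hne, rfl⟩; exact ⟨⟨ht, hne, hc⟩, rfl⟩
    · rw [(Finset.mem_filter.1 ht).2.2]
  rw [Finset.sum_congr rfl hinner]
  ring

/-- The cross-section of the point `ω t`, as a vector of natural numbers. [folklore] -/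
private def csec (ω : ℕ → Site (d + 2)) (t : ℕ) : Fin (d + 1) → ℕ := fun j => (ω t j.succ).toNat

/-- The cross-section lies in the box `{0,…,L}^{d+1}`. [folklore] -/
private theorem csec_mem_box (hW : TubeWalk L ω n) {t : ℕ} (ht : t ≤ n) :
    csec ω t ∈ Fintype.piFinset fun _ : Fin (d + 1) => Finset.range (L + 1) := by
  rw [Fintype.mem_piFinset]
  intro j
  have := hW.box t ht j.succ (Fin.succ_ne_zero j)
  simp only [csec, Finset.mem_range]
  omega

/-- Points with the same cross-section agree off the column coordinate. [folklore] -/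
private theorem eq_of_csec_eq (hW : TubeWalk L ω n) {t t' : ℕ} (ht : t ≤ n) (ht' : t' ≤ n)
    (h : csec ω t = csec ω t') : ∀ i : Fin (d + 2), i ≠ 0 → ω t i = ω t' i := by
  intro i hi
  obtain ⟨j, rfl⟩ := Fin.exists_succ_eq.2 hi
  have hj := congrFun h j
  simp only [csec] at hj
  have h1 := hW.box t ht j.succ (Fin.succ_ne_zero j)
  have h2 := hW.box t' ht' j.succ (Fin.succ_ne_zero j)
  omega

/-- The box `{0,…,L}^{d+1}` has `(L+1)^{d+1}` points. [folklore] -/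
private theorem card_box (L : ℕ) :
    (Fintype.piFinset fun _ : Fin (d + 1) => Finset.range (L + 1)).card = (L + 1) ^ (d + 1) := by
  rw [Fintype.card_piFinset, Finset.prod_const, Finset.card_range, Finset.card_univ, Fintype.card_fin]

/-- A cut has at most `(L+1)^{d+1}` strands (distinct strands have distinct cross-sections).
[folklore] -/
private theorem card_crossTimes_le (hW : TubeWalk L ω n) (c : ℤ) :
    (crossTimes ω n c).card ≤ (L + 1) ^ (d + 1) := by
  rw [← card_box (d := d) L]
  refine Finset.card_le_card_of_injOn (csec ω) (fun t ht => ?_) (fun t ht t' ht' h => ?_)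
  · exact csec_mem_box hW (mem_crossTimes.1 ht).1.le
  · exact crossTimes_pos_inj hW.inj hW.rest ht ht'
      (eq_of_csec_eq hW (mem_crossTimes.1 ht).1.le (mem_crossTimes.1 ht').1.le h)

/-- **Cost bound**: each cut costs at most `κ = 2(L+1)^{d+1} + 2L + 2` extra steps. [folklore] -/
private theorem cost_le (hW : TubeWalk L ω n) {c : ℤ} (hc : c ∈ cuts ω n) :
    cost L ω n c ≤ 2 * (L + 1) ^ (d + 1) + 2 * L + 2 := by
  obtain ⟨T, hT, htop⟩ := exists_isTop hW.adj hc
  have huniq : ∀ t ∈ crossTimes ω n c, t ≠ T → ¬ IsTop ω n c t :=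
    fun t ht htT h => htT (isTop_unique ht hT h htop)
  rw [cost, ← Finset.add_sum_erase _ _ hT]
  have h2 : ∑ t ∈ (crossTimes ω n c).erase T, extra L ω n c t = 2 * ((crossTimes ω n c).card - 1) := by
    rw [Finset.sum_congr rfl fun t ht => ?_, Finset.sum_const, Finset.card_erase_of_mem hT,
      smul_eq_mul, mul_comm]
    rw [extra, if_neg (huniq t (Finset.mem_of_mem_erase ht) (Finset.ne_of_mem_erase ht))]
  rw [h2, extra, if_pos htop]
  have hk := card_crossTimes_le hW c
  have hpos : 1 ≤ (crossTimes ω n c).card := Finset.card_pos.2 ⟨T, hT⟩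
  have : L + 1 - (ω T (hI d)).toNat ≤ L + 1 := Nat.sub_le _ _
  generalize (L + 1) ^ (d + 1) = P at hk ⊢
  omega

/-- There are at most `n` cuts. [folklore] -/
private theorem card_cuts_le (ω : ℕ → Site (d + 2)) (n : ℕ) : (cuts ω n).card ≤ n := by
  unfold cuts
  exact Finset.card_image_le.trans ((Finset.card_filter_le _ _).trans (by simp))

/-! ### Every tube walk has at least `n/(L+1)^{d+1}` cuts -/

/-- Discrete intermediate value property (upwards). [folklore] -/
private theorem exists_cross_up {f : ℕ → ℤ} {v : ℤ} :
    ∀ b a : ℕ, (∀ t < b, f (t + 1) ≤ f t + 1) → a < b → f a ≤ v → v < f b →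
      ∃ t < b, f t = v ∧ f (t + 1) = v + 1
  | 0, a, _, hab, _, _ => absurd hab (Nat.not_lt_zero a)
  | b + 1, a, hf, hab, ha, hb => by
    by_cases h : f b ≤ v
    · have := hf b (Nat.lt_succ_self b)
      exact ⟨b, Nat.lt_succ_self b, by omega, by omega⟩
    · have hab' : a < b := by
        rcases Nat.lt_succ_iff_lt_or_eq.1 hab with h' | rfl
        · exact h'
        · exact absurd ha h
      obtain ⟨t, ht, h1, h2⟩ :=
        exists_cross_up b a (fun t ht => hf t (by omega)) hab' ha (by omega)
      exact ⟨t, by omega, h1, h2⟩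

/-- Discrete intermediate value property (downwards). [folklore] -/
private theorem exists_cross_down {f : ℕ → ℤ} {v : ℤ} :
    ∀ b a : ℕ, (∀ t < b, f t ≤ f (t + 1) + 1) → a < b → v < f a → f b ≤ v →
      ∃ t < b, f t = v + 1 ∧ f (t + 1) = v
  | 0, a, _, hab, _, _ => absurd hab (Nat.not_lt_zero a)
  | b + 1, a, hf, hab, ha, hb => by
    by_cases h : v < f b
    · have := hf b (Nat.lt_succ_self b)
      exact ⟨b, Nat.lt_succ_self b, by omega, by omega⟩
    · have hab' : a < b := by
        rcases Nat.lt_succ_iff_lt_or_eq.1 hab with h' | rfl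
        · exact h'
        · exact absurd ha h
      obtain ⟨t, ht, h1, h2⟩ :=
        exists_cross_down b a (fun t ht => hf t (by omega)) hab' ha (by omega)
      exact ⟨t, by omega, h1, h2⟩

/-- Consecutive columns of a nearest-neighbour walk differ by at most one. [folklore] -/
private theorem TubeWalk.col_step (hW : TubeWalk L ω n) {t : ℕ} (ht : t < n) :
    ω (t + 1) 0 ≤ ω t 0 + 1 ∧ ω t 0 ≤ ω (t + 1) 0 + 1 := by
  have hadj := hW.adj t ht
  rw [zdGraph_adj_iff] at hadj
  obtain ⟨i, h | h⟩ := hadj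
  · have := congrFun h 0
    by_cases hi : i = 0
    · subst hi; simp at this; omega
    · simp [Pi.single_eq_of_ne (Ne.symm hi)] at this; omega
  · have := congrFun h 0
    by_cases hi : i = 0
    · subst hi; simp at this; omega
    · simp [Pi.single_eq_of_ne (Ne.symm hi)] at this; omega

/-- The columns visited by `ω` up to time `n`. [folklore] -/
private def cols (ω : ℕ → Site (d + 2)) (n : ℕ) : Finset ℤ := (Finset.range (n + 1)).image fun t => ω t 0

/-- Every visited column below another visited column is a cut. [folklore] -/
private theorem mem_cuts_of_lt (hW : TubeWalk L ω n) {v : ℤ} (hv : v ∈ cols ω n) {s : ℕ} (hs : s ≤ n)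
    (hvs : v < ω s 0) : v ∈ cuts ω n := by
  obtain ⟨a, ha, hav⟩ := Finset.mem_image.1 hv
  have han : a ≤ n := by simpa [Nat.lt_succ_iff] using ha
  have hne : a ≠ s := by rintro rfl; rw [hav] at hvs; exact lt_irrefl _ hvs
  rcases lt_or_gt_of_ne hne with has | hsa
  · obtain ⟨t, hts, h1, h2⟩ := exists_cross_up (f := fun t => ω t 0) s a
      (fun t ht => (hW.col_step (by omega)).1) has hav.le hvs
    refine mem_cuts.2 ⟨t, by omega, by omega, ?_⟩
    unfold cutOf; rw [h1, h2]; simp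
  · obtain ⟨t, hta, h1, h2⟩ := exists_cross_down (f := fun t => ω t 0) a s
      (fun t ht => (hW.col_step (by omega)).2) hsa hvs hav.le
    refine mem_cuts.2 ⟨t, by omega, by omega, ?_⟩
    unfold cutOf; rw [h1, h2]; simp

/-- Pigeonhole: `n + 1 ≤ #columns · (L+1)^{d+1}`. [folklore] -/
private theorem succ_le_card_cols_mul (hW : TubeWalk L ω n) :
    n + 1 ≤ (cols ω n).card * (L + 1) ^ (d + 1) := by
  have h := Finset.card_le_card_of_injOn (s := Finset.range (n + 1))
    (t := cols ω n ×ˢ Fintype.piFinset fun _ : Fin (d + 1) => Finset.range (L + 1))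
    (fun t => (ω t 0, csec ω t)) (fun t ht => ?_) (fun t ht t' ht' h => ?_)
  · simpa [card_box] using h
  · have ht' : t ≤ n := by simpa [Nat.lt_succ_iff] using ht
    simp only [Finset.coe_product, Set.mem_prod, Finset.mem_coe]
    exact ⟨Finset.mem_image.2 ⟨t, by simpa using ht, rfl⟩, csec_mem_box hW ht'⟩
  · have htn : t ≤ n := by simpa [Nat.lt_succ_iff] using ht
    have htn' : t' ≤ n := by simpa [Nat.lt_succ_iff] using ht'
    simp only [Prod.mk.injEq] at h
    refine hW.inj htn htn' (funext fun i => ?_)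
    by_cases hi : i = 0
    · subst hi; exact h.1
    · exact eq_of_csec_eq hW htn htn' h.2 i hi

/-- **Every `n`-step tube walk has at least `n / (L+1)^{d+1}` cuts.** [folklore] -/
private theorem div_le_card_cuts (hW : TubeWalk L ω n) : n / (L + 1) ^ (d + 1) ≤ (cuts ω n).card := by
  have hne : (cols ω n).Nonempty := ⟨ω 0 0, Finset.mem_image.2 ⟨0, by simp, rfl⟩⟩
  obtain ⟨s, hs, hmax⟩ := Finset.mem_image.1 (Finset.max'_mem _ hne)
  have hsn : s ≤ n := by simpa [Nat.lt_succ_iff] using hs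
  have hsub : (cols ω n).erase (ω s 0) ⊆ cuts ω n := by
    intro v hv
    have hv' := Finset.mem_of_mem_erase hv
    refine mem_cuts_of_lt hW hv' hsn (lt_of_le_of_ne ?_ (Finset.ne_of_mem_erase hv))
    rw [hmax]; exact Finset.le_max' _ _ hv'
  have h1 := Finset.card_le_card hsub
  rw [Finset.card_erase_of_mem (by rw [hmax]; exact Finset.max'_mem _ hne)] at h1
  have h2 := succ_le_card_cols_mul hW
  set P := (L + 1) ^ (d + 1) with hP
  have hP0 : 0 < P := by rw [hP]; positivity
  have h3 : n / P * P ≤ n := Nat.div_mul_le_self n P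
  have h4 : n / P < (cols ω n).card := by
    by_contra h
    have : (cols ω n).card * P ≤ n / P * P := Nat.mul_le_mul_right _ (not_lt.1 h)
    omega
  omega

/-! ### Injectivity: recovering `ω` from the image (given `R`) -/

section Good

open Classical in
/-- The Boolean test "the column of `z` is in the range of `σ_R`". [folklore] -/
private def isGood (R : Finset ℤ) (z : Site (d + 2)) : Bool := decide (∃ x, z 0 = colMap R x)

open Classical in
/-- Anchors pass the test `isGood`. [folklore] -/
private theorem isGood_smap (R : Finset ℤ) (p : Site (d + 2)) : isGood R (smap R p) = true := by
  unfold isGood; exact decide_eq_true ⟨p 0, rfl⟩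

open Classical in
/-- Inserted points fail the test `isGood`. [folklore] -/
private theorem isGood_eq_false {R : Finset ℤ} {c : ℤ} (hc : c ∈ R) {z : Site (d + 2)}
    (hz : z 0 = colMap R c + 1 ∨ z 0 = colMap R c + 2) : isGood R z = false := by
  unfold isGood
  rw [decide_eq_false_iff_not]
  rintro ⟨x, hx⟩
  rcases hz with h | h
  · exact colMap_ne_ins hc x (j := 1) (by norm_num) (by norm_num) (hx.symm.trans h)
  · exact colMap_ne_ins hc x (j := 2) (by norm_num) (by norm_num) (hx.symm.trans h)

/-- Filtering a block to the columns in the range of `σ_R` leaves its anchor. [folklore] -/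
private theorem filter_good_block (hW : TubeWalk L ω n) {t : ℕ} (ht : t < n) :
    (block L R ω n t).filter (isGood R) = [smap R (ω t)] := by
  have hcons : ∃ rest, block L R ω n t = smap R (ω t) :: rest := by
    unfold block excursion; split_ifs <;> exact ⟨_, rfl⟩
  obtain ⟨rest, hrest⟩ := hcons
  have hbad : ∀ z ∈ rest, ¬ isGood R z = true := by
    intro z hz
    have hz' : z ∈ block L R ω n t := by rw [hrest]; exact List.mem_cons_of_mem _ hz
    have hnd := nodup_block (R := R) hW ht
    rw [hrest, List.nodup_cons] at hnd
    rcases mem_block hW ht hz' with h | ⟨-, hRc, hcol, -⟩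
    · exact absurd (h ▸ hz) hnd.1
    · rw [isGood_eq_false hRc hcol]; exact Bool.false_ne_true
  rw [hrest, List.filter_cons_of_pos (isGood_smap R (ω t)), List.filter_eq_nil_iff.2 hbad]

/-- **Recovering `ω`**: the image points in the columns of `σ_R(ℤ)` are exactly the anchors
`σ_R(ω 0), …, σ_R(ω n)`, in order. [folklore] -/
private theorem filter_good_imageList (hW : TubeWalk L ω n) :
    (imageList L R ω n).filter (isGood R) = (List.range (n + 1)).map fun t => smap R (ω t) := by
  rw [imageList, List.filter_append, List.filter_flatMap,
    List.flatMap_congr fun t ht => filter_good_block hW (List.mem_range.1 ht),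
    ← List.map_eq_flatMap, List.filter_cons_of_pos (isGood_smap R (ω n)),
    List.filter_nil, List.range_succ, List.map_append, List.map_singleton]

end Good

/-! ### Injectivity: recovering `R` from the image -/

/-- The inserted columns of `R`. [folklore] -/
private def insCols (R : Finset ℤ) : Finset ℤ := R.biUnion fun c => {colMap R c + 1, colMap R c + 2}

/-- Membership in `insCols`. [folklore] -/
private theorem mem_insCols {R : Finset ℤ} {y : ℤ} :
    y ∈ insCols R ↔ ∃ c ∈ R, y = colMap R c + 1 ∨ y = colMap R c + 2 := by
  simp [insCols]

/-- No column of `σ_R(ℤ)` is an inserted column. [folklore] -/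
private theorem colMap_not_mem_insCols (R : Finset ℤ) (x : ℤ) : colMap R x ∉ insCols R := by
  rw [mem_insCols]
  rintro ⟨c, hc, h | h⟩
  · exact colMap_ne_ins hc x (j := 1) (by norm_num) (by norm_num) h
  · exact colMap_ne_ins hc x (j := 2) (by norm_num) (by norm_num) h

/-- `x ∈ R` iff the column after `σ_R(x)` is inserted. [folklore] -/
private theorem mem_iff_succ_mem_insCols (R : Finset ℤ) (x : ℤ) : x ∈ R ↔ colMap R x + 1 ∈ insCols R := by
  constructor
  · intro hx; exact mem_insCols.2 ⟨x, hx, Or.inl rfl⟩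
  · intro h
    by_contra hx
    rw [← colMap_succ_of_not_mem hx] at h
    exact colMap_not_mem_insCols R _ h

/-- `x ∈ R` iff the column before `σ_R(x+1)` is inserted. [folklore] -/
private theorem mem_iff_pred_mem_insCols (R : Finset ℤ) (x : ℤ) :
    x ∈ R ↔ colMap R (x + 1) - 1 ∈ insCols R := by
  constructor
  · intro hx
    rw [colMap_succ_of_mem hx]
    exact mem_insCols.2 ⟨x, hx, Or.inr (by ring)⟩
  · intro h
    by_contra hx
    rw [colMap_succ_of_not_mem hx, add_sub_cancel_right] at h
    exact colMap_not_mem_insCols R _ h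

/-- `σ_R` is determined by its set of skipped columns. [folklore] -/
private theorem colMap_eq_of_insCols_eq {R R' : Finset ℤ} (h : insCols R = insCols R') (x : ℤ) :
    colMap R x = colMap R' x := by
  induction x using Int.induction_on with
  | zero => rw [colMap_zero, colMap_zero]
  | succ i ih =>
    have hm : (i : ℤ) ∈ R ↔ (i : ℤ) ∈ R' := by
      rw [mem_iff_succ_mem_insCols R, mem_iff_succ_mem_insCols R', ih, h]
    rw [colMap_succ, colMap_succ, ih]
    by_cases hi : (i : ℤ) ∈ R
    · rw [if_pos hi, if_pos (hm.1 hi)]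
    · rw [if_neg hi, if_neg (fun h' => hi (hm.2 h'))]
  | pred i ih =>
    have e1 := colMap_succ R (-(i : ℤ) - 1)
    have e2 := colMap_succ R' (-(i : ℤ) - 1)
    rw [sub_add_cancel] at e1 e2
    have hm : (-(i : ℤ) - 1) ∈ R ↔ (-(i : ℤ) - 1) ∈ R' := by
      rw [mem_iff_pred_mem_insCols R, mem_iff_pred_mem_insCols R', sub_add_cancel, ih, h]
    by_cases hi : (-(i : ℤ) - 1) ∈ R
    · rw [if_pos hi] at e1; rw [if_pos (hm.1 hi)] at e2; omega
    · rw [if_neg hi] at e1; rw [if_neg (fun h' => hi (hm.2 h'))] at e2; omega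

/-- **Recovering `R`**: the set of inserted columns determines `R`. [folklore] -/
private theorem insCols_injective {R R' : Finset ℤ} (h : insCols R = insCols R') : R = R' := by
  ext x
  rw [mem_iff_succ_mem_insCols R x, mem_iff_succ_mem_insCols R' x, colMap_eq_of_insCols_eq h x, h]

/-- The columns of the points of a list at row `L + 1`. [folklore] -/
private def tallCols (L : ℕ) (l : List (Site (d + 2))) : Finset ℤ :=
  (l.toFinset.filter fun z => z (hI d) = (L : ℤ) + 1).image fun z => z 0

/-- Membership in `tallCols`. [folklore] -/
private theorem mem_tallCols {L : ℕ} {l : List (Site (d + 2))} {y : ℤ} :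
    y ∈ tallCols L l ↔ ∃ z ∈ l, z (hI d) = (L : ℤ) + 1 ∧ z 0 = y := by
  simp [tallCols, and_assoc]

/-- **The tall columns of the image are exactly the inserted columns** (for `R ⊆ cuts`):
a point of height `L + 1` is an excursion top, and every cut of `R` has one in each inserted column.
[folklore] -/
private theorem tallCols_imageList (hW : TubeWalk L ω n) (hR : R ⊆ cuts ω n) :
    tallCols L (imageList L R ω n) = insCols R := by
  ext y
  rw [mem_tallCols, mem_insCols]
  constructor
  · rintro ⟨z, hz, hz1, rfl⟩
    rw [imageList, List.mem_append, List.mem_flatMap, List.mem_singleton] at hz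
    rcases hz with ⟨t, ht, hzt⟩ | rfl
    · rcases mem_block hW (List.mem_range.1 ht) hzt with rfl | ⟨-, hRc, hcol, -⟩
      · have := hW.box t (List.mem_range.1 ht).le (hI d) (hI_ne_zero d)
        rw [smap_ne _ _ (hI_ne_zero d)] at hz1; omega
      · exact ⟨_, hRc, hcol⟩
    · have := hW.box n le_rfl (hI d) (hI_ne_zero d)
      rw [smap_ne _ _ (hI_ne_zero d)] at hz1; omega
  · rintro ⟨c, hc, hy⟩
    obtain ⟨T, hT, htop⟩ := exists_isTop hW.adj (hR hc)
    obtain ⟨hTn, hTc⟩ := mem_crossTimes.1 hT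
    have hne := hTc.ne
    have hcut := hTc.cutOf_eq
    have hb := hW.box T hTn.le (hI d) (hI_ne_zero d)
    set J := L + 1 - (ω T (hI d)).toNat with hJdef
    have hJ : ω T (hI d) + (J : ℤ) = (L : ℤ) + 1 := by
      have := Int.toNat_of_nonneg hb.1; omega
    obtain ⟨hg, -, -⟩ := crossing_geometry hW hTn hne (hcut.symm ▸ hc)
    rw [hcut] at hg
    have hblock : block L R ω n T = excursion (smap R (ω T)) (ω (T + 1) 0 - ω T 0) J := by
      unfold block; rw [if_pos ⟨hne, hcut.symm ▸ hc⟩, hcut, if_pos htop]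
    have hmem : ∀ z ∈ block L R ω n T, z ∈ imageList L R ω n := fun z hz => by
      rw [imageList, List.mem_append, List.mem_flatMap]
      exact Or.inl ⟨T, List.mem_range.2 hTn, hz⟩
    have hup : smap R (ω T) + cvec d (ω (T + 1) 0 - ω T 0) + hvec d (J : ℤ) ∈ block L R ω n T := by
      rw [hblock]; unfold excursion
      refine List.mem_cons_of_mem _ (List.mem_append_left _ (List.mem_map.2 ⟨J, ?_, rfl⟩))
      simp
    have hdown : smap R (ω T) + cvec d (2 * (ω (T + 1) 0 - ω T 0)) + hvec d (J : ℤ) ∈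
        block L R ω n T := by
      rw [hblock]; unfold excursion
      refine List.mem_cons_of_mem _ (List.mem_append_right _ (List.mem_reverse.2
        (List.mem_map.2 ⟨J, ?_, rfl⟩)))
      simp
    have e_up : (smap R (ω T) + cvec d (ω (T + 1) 0 - ω T 0) + hvec d (J : ℤ)) (hI d) = (L : ℤ) + 1 := by
      simp [hI_ne_zero]; exact hJ
    have e_down : (smap R (ω T) + cvec d (2 * (ω (T + 1) 0 - ω T 0)) + hvec d (J : ℤ)) (hI d) =
        (L : ℤ) + 1 := by
      simp [hI_ne_zero]; exact hJ
    rcases hy with rfl | rfl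
    · rcases hg with ⟨g, -⟩ | ⟨-, g⟩
      · exact ⟨_, hmem _ hup, e_up, by simp [g]⟩
      · exact ⟨_, hmem _ hdown, e_down, by simp [g]⟩
    · rcases hg with ⟨-, g⟩ | ⟨g, -⟩
      · exact ⟨_, hmem _ hdown, e_down, by simp [g]⟩
      · exact ⟨_, hmem _ hup, e_up, by simp [g]⟩

/-- **Injectivity of `(ω, R) ↦ Ψ(ω, R)`** on tube walks with `R ⊆ cuts(ω)` (list form).
[folklore] -/
private theorem imageList_inj {ω' : ℕ → Site (d + 2)} {R' : Finset ℤ} (hW : TubeWalk L ω n)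
    (hW' : TubeWalk L ω' n) (hR : R ⊆ cuts ω n) (hR' : R' ⊆ cuts ω' n)
    (h : imageList L R ω n = imageList L R' ω' n) : R = R' ∧ ∀ t ≤ n, ω t = ω' t := by
  classical
  have hRR : R = R' := by
    apply insCols_injective
    rw [← tallCols_imageList hW hR, ← tallCols_imageList hW' hR', h]
  subst hRR
  refine ⟨rfl, fun t ht => ?_⟩
  have hf := filter_good_imageList (R := R) hW
  rw [h, filter_good_imageList hW'] at hf
  have := List.map_inj_left.1 hf.symm t (List.mem_range.2 (Nat.lt_succ_of_le ht))
  exact smap_injective R this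

/-- **Injectivity of `Ψ`** (function form): equal images force `R = R'` and `ω = ω'` on `[0, n]`.
[folklore] -/
private theorem psi_inj {ω' : ℕ → Site (d + 2)} {R' : Finset ℤ} (hW : TubeWalk L ω n)
    (hW' : TubeWalk L ω' n) (h0 : ω 0 = ω' 0) (hR : R ⊆ cuts ω n) (hR' : R' ⊆ cuts ω' n)
    (hlen : (imageList L R ω n).length = (imageList L R' ω' n).length)
    (h : psi L R ω n = psi L R' ω' n) : R = R' ∧ ∀ t ≤ n, ω t = ω' t := by
  refine imageList_inj hW hW' hR hR' (ofList_inj hlen fun s => ?_)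
  have := congrFun h s
  simp only [psi, h0] at this
  exact sub_left_inj.1 this


/-! ### The finite counting inequality -/

section Counting

variable {a : Site (d + 2)} {υ : ℕ → Site (d + 2)}

/-- The cost bound `κ = 2(L+1)^{d+1} + 2L + 2`. [folklore] -/
private def kappa (d L : ℕ) : ℕ := 2 * (L + 1) ^ (d + 1) + 2 * L + 2

/-- A walk of `tubeWalksFrom (d+2) 1 L n a`, translated by `a`, is a tube walk from `a`. [folklore] -/
private theorem tubeWalk_of_mem (ha : a ∈ tubeStarts (d + 2) 1 L) (hυ : υ ∈ tubeWalksFrom (d + 2) 1 L n a) :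
    TubeWalk L (fun t => a + υ t) n ∧ a + υ 0 = a ∧ a 0 = 0 := by
  obtain ⟨hs, hT⟩ := mem_tubeWalksFrom.1 hυ
  obtain ⟨h0, -, hadj, hinj⟩ := mem_saws.1 hs
  obtain ⟨-, ha0⟩ := mem_tubeStarts.1 ha
  refine ⟨⟨fun t ht => ?_, fun t ht t' ht' h => hinj ht ht' (add_left_cancel h),
    fun t ht i hi => (hT t ht) i ?_⟩, by simp [h0], ha0 0 (by simp)⟩
  · rw [add_comm a, add_comm a, zdGraph_adj_add_right]
    exact hadj t ht
  · have : i.val ≠ 0 := fun h => hi (Fin.ext h)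
    omega

/-- The pairs `(υ, R)`: a tube walk from `a` and a set of its cuts. [folklore] -/
private def dom (L n : ℕ) (a : Site (d + 2)) : Finset (Σ _ : ℕ → Site (d + 2), Finset ℤ) :=
  (tubeWalksFrom (d + 2) 1 L n a).sigma fun υ => (cuts (fun t => a + υ t) n).powerset

/-- The length of the image of a pair. [folklore] -/
private def len (L n : ℕ) (a : Site (d + 2)) (p : Σ _ : ℕ → Site (d + 2), Finset ℤ) : ℕ :=
  n + ∑ c ∈ p.2, cost L (fun t => a + p.1 t) n c

/-- Membership in `dom`. [folklore] -/
private theorem mem_dom {p : Σ _ : ℕ → Site (d + 2), Finset ℤ} :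
    p ∈ dom L n a ↔ p.1 ∈ tubeWalksFrom (d + 2) 1 L n a ∧ p.2 ⊆ cuts (fun t => a + p.1 t) n := by
  rw [dom, Finset.mem_sigma, Finset.mem_powerset]

/-- The image length of a pair is at most `(κ+1)n`. [folklore] -/
private theorem len_le (ha : a ∈ tubeStarts (d + 2) 1 L) {p : Σ _ : ℕ → Site (d + 2), Finset ℤ} (hp : p ∈ dom L n a) :
    len L n a p ≤ (kappa d L + 1) * n := by
  obtain ⟨hυ, hR⟩ := mem_dom.1 hp
  obtain ⟨hW, -, -⟩ := tubeWalk_of_mem ha hυ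
  have h1 : ∑ c ∈ p.2, cost L (fun t => a + p.1 t) n c ≤ ∑ _c ∈ p.2, kappa d L :=
    Finset.sum_le_sum fun c hc => cost_le hW (hR hc)
  rw [Finset.sum_const, smul_eq_mul] at h1
  have h2 := (Finset.card_le_card hR).trans (card_cuts_le (fun t => a + p.1 t) n)
  unfold len
  nlinarith

/-- The image of a pair is a `(len)`-step walk of the wider tube. [folklore] -/
private theorem psi_mem_of_mem_dom (ha : a ∈ tubeStarts (d + 2) 1 L) {p : Σ _ : ℕ → Site (d + 2), Finset ℤ}
    (hp : p ∈ dom L n a) :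
    psi L p.2 (fun t => a + p.1 t) n ∈ tubeWalksFrom (d + 2) 1 (L + 1) (len L n a p) a := by
  obtain ⟨hυ, -⟩ := mem_dom.1 hp
  obtain ⟨hW, h0, ha0⟩ := tubeWalk_of_mem ha hυ
  have h := psi_mem_tubeWalksFrom hW (show (a + p.1 0) 0 = 0 by rw [h0]; exact ha0) p.2
  rw [length_imageList hW] at h
  have e : n + 1 + ∑ c ∈ p.2, cost L (fun t => a + p.1 t) n c - 1 = len L n a p := by
    unfold len; omega
  rw [e] at h
  simpa only [h0] using h

/-- **Injectivity on the pairs of a given image length.** [folklore] -/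
private theorem psi_injOn (ha : a ∈ tubeStarts (d + 2) 1 L) (m : ℕ) :
    Set.InjOn (fun p : Σ _ : ℕ → Site (d + 2), Finset ℤ => psi L p.2 (fun t => a + p.1 t) n)
      ↑((dom L n a).filter fun p => len L n a p = m) := by
  intro p hp p' hp' h
  rw [Finset.coe_filter, Set.mem_setOf_eq] at hp hp'
  obtain ⟨⟨hυ, hR⟩, hl⟩ := And.imp_left mem_dom.1 hp
  obtain ⟨⟨hυ', hR'⟩, hl'⟩ := And.imp_left mem_dom.1 hp'
  obtain ⟨hW, h0, -⟩ := tubeWalk_of_mem ha hυ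
  obtain ⟨hW', h0', -⟩ := tubeWalk_of_mem ha hυ'
  have hlen : (imageList L p.2 (fun t => a + p.1 t) n).length =
      (imageList L p'.2 (fun t => a + p'.1 t) n).length := by
    rw [length_imageList hW, length_imageList hW']
    unfold len at hl hl'
    omega
  obtain ⟨hRR, hω⟩ := psi_inj hW hW' (show a + p.1 0 = a + p'.1 0 by rw [h0, h0']) hR hR' hlen h
  have hυυ : p.1 = p'.1 := by
    obtain ⟨-, he, -, -⟩ := mem_saws.1 (mem_tubeWalksFrom.1 hυ).1
    obtain ⟨-, he', -, -⟩ := mem_saws.1 (mem_tubeWalksFrom.1 hυ').1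
    funext t
    rcases le_or_gt t n with ht | ht
    · exact add_left_cancel (hω t ht)
    · rw [he t ht.le, he' t ht.le]; exact add_left_cancel (hω n le_rfl)
  exact Sigma.ext hυυ (heq_of_eq hRR)

/-- The generating polynomial of the pairs, by image length. [folklore] -/
private theorem sum_dom_eq (ha : a ∈ tubeStarts (d + 2) 1 L) (x : ℝ) :
    ∑ p ∈ dom L n a, x ^ len L n a p =
      ∑ m ∈ Finset.range ((kappa d L + 1) * n + 1),
        (((dom L n a).filter fun p => len L n a p = m).card : ℝ) * x ^ m := by
  rw [← Finset.sum_fiberwise_of_maps_to (g := len L n a) (t := Finset.range ((kappa d L + 1) * n + 1))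
    fun p hp => Finset.mem_range.2 (Nat.lt_succ_of_le (len_le ha hp))]
  refine Finset.sum_congr rfl fun m _ => ?_
  rw [Finset.sum_congr rfl fun p hp => by rw [(Finset.mem_filter.1 hp).2], Finset.sum_const,
    nsmul_eq_mul]

/-- **Upper bound** by injectivity. [folklore] -/
private theorem sum_dom_le (ha : a ∈ tubeStarts (d + 2) 1 L) {x : ℝ} (hx : 0 ≤ x) :
    ∑ p ∈ dom L n a, x ^ len L n a p ≤
      ∑ m ∈ Finset.range ((kappa d L + 1) * n + 1),
        ((tubeWalksFrom (d + 2) 1 (L + 1) m a).card : ℝ) * x ^ m := by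
  rw [sum_dom_eq ha]
  refine Finset.sum_le_sum fun m _ => mul_le_mul_of_nonneg_right ?_ (pow_nonneg hx m)
  exact_mod_cast Finset.card_le_card_of_injOn _
    (fun p hp => by
      have hp' := Finset.mem_filter.1 hp
      simpa [hp'.2] using psi_mem_of_mem_dom ha hp'.1)
    (psi_injOn ha m)

/-- **Lower bound**: `Σ_{R ⊆ cuts} x^{len} = x^n Π_{c ∈ cuts} (1 + x^{cost c}) ≥ x^n (1 + x^κ)^{n/(L+1)^{d+1}}`.
[folklore] -/
private theorem le_sum_dom (ha : a ∈ tubeStarts (d + 2) 1 L) {x : ℝ} (hx : 0 ≤ x) (hx1 : x ≤ 1) :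
    ((tubeWalksFrom (d + 2) 1 L n a).card : ℝ) * x ^ n *
        (1 + x ^ kappa d L) ^ (n / (L + 1) ^ (d + 1)) ≤
      ∑ p ∈ dom L n a, x ^ len L n a p := by
  rw [dom, Finset.sum_sigma]
  have key : ∀ υ ∈ tubeWalksFrom (d + 2) 1 L n a,
      x ^ n * (1 + x ^ kappa d L) ^ (n / (L + 1) ^ (d + 1)) ≤
        ∑ R ∈ (cuts (fun t => a + υ t) n).powerset, x ^ len L n a ⟨υ, R⟩ := by
    intro υ hυ
    obtain ⟨hW, -, -⟩ := tubeWalk_of_mem ha hυ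
    show _ ≤ ∑ R ∈ (cuts (fun t => a + υ t) n).powerset,
      x ^ (n + ∑ c ∈ R, cost L (fun t => a + υ t) n c)
    rw [Finset.sum_congr rfl fun R _ => by rw [pow_add, ← Finset.prod_pow_eq_pow_sum],
      ← Finset.mul_sum, ← Finset.prod_one_add]
    refine mul_le_mul_of_nonneg_left ?_ (pow_nonneg hx n)
    calc (1 + x ^ kappa d L) ^ (n / (L + 1) ^ (d + 1))
        ≤ (1 + x ^ kappa d L) ^ (cuts (fun t => a + υ t) n).card :=
          pow_le_pow_right₀ (by linarith [pow_nonneg hx (kappa d L)]) (div_le_card_cuts hW)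
      _ = ∏ _c ∈ cuts (fun t => a + υ t) n, (1 + x ^ kappa d L) := (Finset.prod_const _).symm
      _ ≤ ∏ c ∈ cuts (fun t => a + υ t) n, (1 + x ^ cost L (fun t => a + υ t) n c) :=
          Finset.prod_le_prod (fun c _ => by linarith [pow_nonneg hx (kappa d L)]) fun c hc => by
            have : x ^ kappa d L ≤ x ^ cost L (fun t => a + υ t) n c :=
              pow_le_pow_of_le_one hx hx1 (cost_le hW hc)
            linarith
  calc ((tubeWalksFrom (d + 2) 1 L n a).card : ℝ) * x ^ n * (1 + x ^ kappa d L) ^ (n / (L + 1) ^ (d + 1))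
      = ∑ _υ ∈ tubeWalksFrom (d + 2) 1 L n a, x ^ n * (1 + x ^ kappa d L) ^ (n / (L + 1) ^ (d + 1)) := by
        rw [Finset.sum_const, nsmul_eq_mul, mul_assoc]
    _ ≤ _ := Finset.sum_le_sum key

/-- **The finite core** (one start cross-section `a`): for `0 ≤ x ≤ 1` and every `n`,
`#(n-step walks of T_L from a) · xⁿ · (1 + x^κ)^{⌊n/(L+1)^{d+1}⌋} ≤ Σ_{m ≤ (κ+1)n} #(m-step walks of T_{L+1} from a) · x^m`.
[folklore] -/
private theorem finite_core (ha : a ∈ tubeStarts (d + 2) 1 L) {x : ℝ} (hx : 0 ≤ x) (hx1 : x ≤ 1) :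
    ((tubeWalksFrom (d + 2) 1 L n a).card : ℝ) * x ^ n *
        (1 + x ^ kappa d L) ^ (n / (L + 1) ^ (d + 1)) ≤
      ∑ m ∈ Finset.range ((kappa d L + 1) * n + 1),
        ((tubeWalksFrom (d + 2) 1 (L + 1) m a).card : ℝ) * x ^ m :=
  (le_sum_dom ha hx hx1).trans (sum_dom_le ha hx)

end Counting

/-! ### Extraction of the margins: analysis -/

section Extraction

/-- For `0 < x < 1/γ` and `C_m^{1/m} → γ`, the sequence `C_m x^m` is bounded. [folklore] -/
private theorem exists_bound_of_tendsto_rpow {C : ℕ → ℝ} {γ x : ℝ} (hC0 : ∀ m, 0 ≤ C m)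
    (hC : Tendsto (fun m : ℕ => C m ^ (1 / (m : ℝ))) atTop (𝓝 γ)) (hγ : 0 < γ) (hx : 0 < x)
    (hxγ : x < 1 / γ) : ∃ K : ℝ, 0 ≤ K ∧ ∀ m, C m * x ^ m ≤ K := by
  set u : ℝ := (γ + x⁻¹) / 2 with hu
  have hxinv : γ < x⁻¹ := by
    have := (lt_one_div hx hγ).1 hxγ; rwa [one_div] at this
  have hγu : γ < u := by rw [hu]; linarith
  have hux : u * x ≤ 1 := by
    have : u < x⁻¹ := by rw [hu]; linarith
    have h1 : u * x < x⁻¹ * x := mul_lt_mul_of_pos_right this hx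
    rw [inv_mul_cancel₀ hx.ne'] at h1
    exact h1.le
  have hu0 : 0 ≤ u := by rw [hu]; positivity
  have hev : ∀ᶠ m : ℕ in atTop, C m * x ^ m ≤ 1 := by
    filter_upwards [hC.eventually_lt_const hγu, eventually_ge_atTop 1] with m hm hm1
    have hm0 : (m : ℕ) ≠ 0 := by omega
    have h1 : C m = (C m ^ (1 / (m : ℝ))) ^ m := by
      rw [one_div, Real.rpow_inv_natCast_pow (hC0 m) hm0]
    have h2 : C m ≤ u ^ m := by
      rw [h1]; exact pow_le_pow_left₀ (Real.rpow_nonneg (hC0 m) _) hm.le m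
    calc C m * x ^ m ≤ u ^ m * x ^ m := mul_le_mul_of_nonneg_right h2 (pow_nonneg hx.le m)
      _ = (u * x) ^ m := (mul_pow u x m).symm
      _ ≤ 1 := pow_le_one₀ (mul_nonneg hu0 hx.le) hux
  obtain ⟨N, hN⟩ := eventually_atTop.1 hev
  refine ⟨1 + ∑ m ∈ Finset.range N, C m * x ^ m, ?_, fun m => ?_⟩
  · have : 0 ≤ ∑ m ∈ Finset.range N, C m * x ^ m :=
      Finset.sum_nonneg fun m _ => mul_nonneg (hC0 m) (pow_nonneg hx.le m)
    linarith
  · rcases lt_or_ge m N with h | h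
    · have : C m * x ^ m ≤ ∑ m ∈ Finset.range N, C m * x ^ m :=
        Finset.single_le_sum (f := fun m => C m * x ^ m)
          (fun m _ => mul_nonneg (hC0 m) (pow_nonneg hx.le m)) (Finset.mem_range.2 h)
      linarith
    · have : 0 ≤ ∑ m ∈ Finset.range N, C m * x ^ m :=
        Finset.sum_nonneg fun m _ => mul_nonneg (hC0 m) (pow_nonneg hx.le m)
      linarith [hN m h]

/-- Exponential versus linear growth: if `yⁿ ≤ D·n` for all `n ≥ 1` then `y ≤ 1`. [folklore] -/
private theorem le_one_of_pow_le_mul {y D : ℝ} (hD : 0 ≤ D) (h : ∀ n : ℕ, 1 ≤ n → y ^ n ≤ D * n) :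
    y ≤ 1 := by
  by_contra hy1
  rw [not_le] at hy1
  have ht := tendsto_pow_const_div_const_pow_of_one_lt 1 hy1
  have hev := ht.eventually_lt_const (show (0 : ℝ) < 1 / (D + 1) by positivity)
  obtain ⟨N, hN⟩ := eventually_atTop.1 hev
  have hN1 := hN (N + 1) (by omega)
  have hn := h (N + 1) (by omega)
  have hpow : 0 < y ^ (N + 1) := pow_pos (by linarith) _
  simp only [pow_one] at hN1
  -- `1 ≤ D (N+1) / y^{N+1} < D/(D+1) < 1`
  have h1 : 1 ≤ D * (((N + 1 : ℕ) : ℝ) / y ^ (N + 1)) := by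
    rw [mul_div_assoc', le_div_iff₀ hpow, one_mul]; exact hn
  have h2 : D * (((N + 1 : ℕ) : ℝ) / y ^ (N + 1)) ≤ D * (1 / (D + 1)) :=
    mul_le_mul_of_nonneg_left hN1.le hD
  have h3 : D * (1 / (D + 1)) < 1 := by
    rw [mul_one_div, div_lt_one (by linarith)]; linarith
  linarith

/-- `n/Q ≤ ⌊n/Q⌋ + 1` between real and natural division (`Q ≥ 1`). [folklore] -/
private theorem div_le_natDiv_add_one (n : ℕ) {Q : ℕ} (hQ : 0 < Q) : (n : ℝ) / (Q : ℝ) ≤ ((n / Q : ℕ) : ℝ) + 1 := by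
  have h := Nat.lt_div_mul_add (a := n) (b := Q) hQ
  have hQ' : (0 : ℝ) < Q := by exact_mod_cast hQ
  rw [div_le_iff₀ hQ']
  have : (n : ℝ) ≤ ((n / Q : ℕ) : ℝ) * (Q : ℝ) + (Q : ℝ) := by exact_mod_cast h.le
  linarith

/-- **Extraction lemma.** If `αⁿ xⁿ (1 + x^E)^{⌊n/Q⌋} ≤ B Σ_{m ≤ Kn} C_m x^m` for all `n` and all
`0 < x ≤ 1`, where `C_m^{1/m} → γ ≥ 1` and `Q ≥ 1`, then `log(1 + γ^{-E})/Q ≤ log γ − log α`. [folklore] -/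
private theorem extract {α γ B : ℝ} {E Q K : ℕ} {C : ℕ → ℝ} (hα : 0 < α) (hγ : 1 ≤ γ) (hB : 0 ≤ B) (hQ : 0 < Q)
    (hC0 : ∀ m, 0 ≤ C m) (hC : Tendsto (fun m : ℕ => C m ^ (1 / (m : ℝ))) atTop (𝓝 γ))
    (h : ∀ n : ℕ, ∀ x : ℝ, 0 < x → x ≤ 1 →
      α ^ n * x ^ n * (1 + x ^ E) ^ (n / Q) ≤ B * ∑ m ∈ Finset.range (K * n + 1), C m * x ^ m) :
    Real.log (1 + γ ^ (-(E : ℝ))) / (Q : ℝ) ≤ Real.log γ - Real.log α := by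
  have hγ0 : 0 < γ := by linarith
  have hQ' : (0 : ℝ) < Q := by exact_mod_cast hQ
  set r : ℝ := 1 / (Q : ℝ) with hr
  have hr0 : 0 ≤ r := by rw [hr]; positivity
  set g : ℝ → ℝ := fun x => α * x * (1 + x ^ E) ^ r with hg
  have hB' : ∀ x : ℝ, 0 ≤ x → x < 1 / γ → g x ≤ 1 := by
    intro x hx0 hxγ
    rcases hx0.eq_or_lt with rfl | hx
    · simp [hg]
    have hx1 : x ≤ 1 := by
      have : 1 / γ ≤ 1 := by rw [div_le_one hγ0]; exact hγ
      linarith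
    obtain ⟨Kx, hKx0, hKx⟩ := exists_bound_of_tendsto_rpow hC0 hC hγ0 hx hxγ
    have hb1 : 1 ≤ 1 + x ^ E := by linarith [pow_nonneg hx.le E]
    have hgx : g x = α * x * (1 + x ^ E) ^ r := rfl
    refine le_one_of_pow_le_mul
      (show 0 ≤ (1 + x ^ E) * B * Kx * ((K : ℝ) + 1) by positivity) fun n hn => ?_
    have e1 : g x ^ n = α ^ n * x ^ n * (1 + x ^ E) ^ (r * n) := by
      rw [hgx, mul_pow, mul_pow, Real.rpow_mul (by linarith), Real.rpow_natCast]
    have e2 : (1 + x ^ E) ^ (r * n) ≤ (1 + x ^ E) ^ (n / Q) * (1 + x ^ E) := by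
      rw [← Real.rpow_natCast (1 + x ^ E) (n / Q), ← Real.rpow_add_one (by linarith)]
      refine Real.rpow_le_rpow_of_exponent_le hb1 ?_
      rw [hr, one_div_mul_eq_div]
      exact div_le_natDiv_add_one n hQ
    have e3 : ∑ m ∈ Finset.range (K * n + 1), C m * x ^ m ≤ ((K * n + 1 : ℕ) : ℝ) * Kx := by
      calc ∑ m ∈ Finset.range (K * n + 1), C m * x ^ m ≤ ∑ _m ∈ Finset.range (K * n + 1), Kx :=
            Finset.sum_le_sum fun m _ => hKx m
        _ = _ := by rw [Finset.sum_const, Finset.card_range, nsmul_eq_mul]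
    have e4 : ((K * n + 1 : ℕ) : ℝ) ≤ ((K : ℝ) + 1) * n := by
      push_cast
      have : (1 : ℝ) ≤ n := by exact_mod_cast hn
      nlinarith
    have hmain := h n x hx hx1
    calc g x ^ n = α ^ n * x ^ n * (1 + x ^ E) ^ (r * n) := e1
      _ ≤ α ^ n * x ^ n * ((1 + x ^ E) ^ (n / Q) * (1 + x ^ E)) :=
          mul_le_mul_of_nonneg_left e2 (by positivity)
      _ = (α ^ n * x ^ n * (1 + x ^ E) ^ (n / Q)) * (1 + x ^ E) := by ring
      _ ≤ (B * ∑ m ∈ Finset.range (K * n + 1), C m * x ^ m) * (1 + x ^ E) :=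
          mul_le_mul_of_nonneg_right hmain (by linarith)
      _ ≤ (B * (((K * n + 1 : ℕ) : ℝ) * Kx)) * (1 + x ^ E) :=
          mul_le_mul_of_nonneg_right (mul_le_mul_of_nonneg_left e3 hB) (by linarith)
      _ ≤ (B * ((((K : ℝ) + 1) * n) * Kx)) * (1 + x ^ E) :=
          mul_le_mul_of_nonneg_right (mul_le_mul_of_nonneg_left
            (mul_le_mul_of_nonneg_right e4 hKx0) hB) (by linarith)
      _ = (1 + x ^ E) * B * Kx * ((K : ℝ) + 1) * n := by ring
  have hcont : Continuous g := by
    rw [hg]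
    exact (continuous_const.mul continuous_id).mul
      ((continuous_const.add (continuous_pow E)).rpow_const fun x => Or.inr hr0)
  set xs : ℕ → ℝ := fun k => (1 / γ) * (1 - 1 / ((k : ℝ) + 1)) with hxs
  have hxs_lim : Tendsto xs atTop (𝓝 (1 / γ)) := by
    have h1 : Tendsto (fun k : ℕ => (1 : ℝ) - 1 / ((k : ℝ) + 1)) atTop (𝓝 (1 - 0)) :=
      tendsto_const_nhds.sub tendsto_one_div_add_atTop_nhds_zero_nat
    have h2 := h1.const_mul (1 / γ)
    rw [sub_zero, mul_one] at h2
    exact h2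
  have hgx0 : g (1 / γ) ≤ 1 := by
    refine le_of_tendsto' ((hcont.tendsto _).comp hxs_lim) fun k => hB' (xs k) ?_ ?_
    · rw [hxs]
      have : (0 : ℝ) ≤ 1 - 1 / ((k : ℝ) + 1) := by
        rw [sub_nonneg, div_le_one (by positivity)]; linarith
      positivity
    · rw [hxs]
      have h1 : (0 : ℝ) < 1 / ((k : ℝ) + 1) := by positivity
      have h2 : 0 < 1 / γ := by positivity
      nlinarith
  have hb : 0 < 1 + γ ^ (-(E : ℝ)) := by positivity
  have hval : g (1 / γ) = α * γ⁻¹ * (1 + γ ^ (-(E : ℝ))) ^ r := by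
    rw [hg]; simp only
    rw [one_div, Real.rpow_neg hγ0.le, Real.rpow_natCast, inv_pow]
  rw [hval] at hgx0
  have hpos : 0 < α * γ⁻¹ * (1 + γ ^ (-(E : ℝ))) ^ r := by positivity
  have hlog := Real.log_nonpos hpos.le hgx0
  rw [Real.log_mul (by positivity) (by positivity), Real.log_mul hα.ne' (by positivity),
    Real.log_inv, Real.log_rpow hb, hr, one_div_mul_eq_div] at hlog
  linarith

end Extraction

/-! ### Assembly -/

section Assembly

/-- The finite core summed over the start cross-sections. [folklore] -/
private theorem summed_core (L n : ℕ) {x : ℝ} (hx : 0 ≤ x) (hx1 : x ≤ 1) :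
    tubeConnectiveConstant (d + 2) 1 L ^ n * x ^ n * (1 + x ^ kappa d L) ^ (n / (L + 1) ^ (d + 1)) ≤
      ∑ a ∈ tubeStarts (d + 2) 1 L, ∑ m ∈ Finset.range ((kappa d L + 1) * n + 1),
        ((tubeWalksFrom (d + 2) 1 (L + 1) m a).card : ℝ) * x ^ m := by
  have h1 : tubeConnectiveConstant (d + 2) 1 L ^ n * x ^ n * (1 + x ^ kappa d L) ^ (n / (L + 1) ^ (d + 1)) ≤
      (tubeCount (d + 2) 1 L n : ℝ) * x ^ n * (1 + x ^ kappa d L) ^ (n / (L + 1) ^ (d + 1)) :=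
    mul_le_mul_of_nonneg_right (mul_le_mul_of_nonneg_right
      (StripInsertion.pow_tubeConnectiveConstant_le_tubeCount le_rfl L n) (pow_nonneg hx n))
      (pow_nonneg (by linarith [pow_nonneg hx (kappa d L)]) _)
  refine h1.trans ?_
  rw [tubeCount_eq_sum]
  push_cast
  rw [Finset.sum_mul, Finset.sum_mul]
  exact Finset.sum_le_sum fun a ha => finite_core ha hx hx1

/-- The cost bound as a real number. [folklore] -/
private theorem kappa_cast (d L : ℕ) : ((kappa d L : ℕ) : ℝ) = 2 * ((L : ℝ) + 1) ^ (d + 1) + 2 * L + 2 := by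
  simp [kappa]

/-- **Quantitative (8.2.11) for the tubes `ℤ × {0,…,L}^{d+1} ⊂ ℤ^{d+2}`** (this file; the source proves
`μ(R) < μ` without a margin): with `κ = 2(L+1)^{d+1} + 2L + 2`,
`log(1 + μ(ℤ^{d+2})^{-κ}) / (L+1)^{d+1} ≤ log μ(ℤ^{d+2}) − log μ(T_L)`.
Printed statement: Theorem 8.2.1, book p. 269 (PDF p0281 [436] = p0210 [340]).
[cite: MadrasSlade1993, §8.2, eq. (8.2.11) (remark before Theorem 8.2.1; quantitative form, this file)] -/
theorem log_connectiveConstant_sub_log_tubeConnectiveConstant_ge (L : ℕ) :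
    Real.log (1 + connectiveConstant (d + 2) ^ (-(2 * ((L : ℝ) + 1) ^ (d + 1) + 2 * L + 2))) /
        ((L : ℝ) + 1) ^ (d + 1) ≤
      Real.log (connectiveConstant (d + 2)) - Real.log (tubeConnectiveConstant (d + 2) 1 L) := by
  have hQ : 0 < (L + 1) ^ (d + 1) := by positivity
  have h := extract (E := kappa d L) (Q := (L + 1) ^ (d + 1)) (K := kappa d L + 1)
    (C := fun m => (count (d + 2) m : ℝ)) (B := ((tubeStarts (d + 2) 1 L).card : ℝ))
    (tubeConnectiveConstant_pos (d := d + 2) le_rfl L) (one_le_connectiveConstant (d + 2))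
    (Nat.cast_nonneg _) hQ (fun m => Nat.cast_nonneg _) (tendsto_count_rpow (d + 2))
    fun n x hx hx1 => (summed_core L n hx.le hx1).trans ?_
  · rw [kappa_cast] at h
    have e : (((L + 1) ^ (d + 1) : ℕ) : ℝ) = ((L : ℝ) + 1) ^ (d + 1) := by push_cast; ring
    rwa [e] at h
  · rw [← nsmul_eq_mul, ← Finset.sum_const]
    refine Finset.sum_le_sum fun a _ => Finset.sum_le_sum fun m _ =>
      mul_le_mul_of_nonneg_right ?_ (pow_nonneg hx.le m)
    rw [← card_saws]
    exact_mod_cast Finset.card_le_card fun υ hυ => (mem_tubeWalksFrom.1 hυ).1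

/-- **Quantitative (8.2.13) for the tubes `ℤ × {0,…,L}^{d+1}`** (this file; the source proves strict
monotonicity without a margin): with `κ = 2(L+1)^{d+1} + 2L + 2`,
`log(1 + μ(T_{L+1})^{-κ}) / (L+1)^{d+1} ≤ log μ(T_{L+1}) − log μ(T_L)`.
Printed statement: Theorem 8.2.1, book p. 269–270 (PDF p0281–p0282 [436] = p0210–p0211 [340]).
[cite: MadrasSlade1993, §8.2, Theorem 8.2.1, eq. (8.2.13) (quantitative form, this file)] -/
theorem log_tubeConnectiveConstant_succ_sub_log_ge (L : ℕ) :
    Real.log (1 + tubeConnectiveConstant (d + 2) 1 (L + 1) ^ (-(2 * ((L : ℝ) + 1) ^ (d + 1) + 2 * L + 2))) /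
        ((L : ℝ) + 1) ^ (d + 1) ≤
      Real.log (tubeConnectiveConstant (d + 2) 1 (L + 1)) - Real.log (tubeConnectiveConstant (d + 2) 1 L) := by
  have hQ : 0 < (L + 1) ^ (d + 1) := by positivity
  have h := extract (E := kappa d L) (Q := (L + 1) ^ (d + 1)) (K := kappa d L + 1)
    (C := fun m => (tubeCount (d + 2) 1 (L + 1) m : ℝ)) (B := ((tubeStarts (d + 2) 1 L).card : ℝ))
    (tubeConnectiveConstant_pos (d := d + 2) le_rfl L) (one_le_tubeConnectiveConstant (d := d + 2) le_rfl _)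
    (Nat.cast_nonneg _) hQ (fun m => Nat.cast_nonneg _) (tendsto_tubeCount_rpow (d := d + 2) le_rfl _)
    fun n x hx hx1 => (summed_core L n hx.le hx1).trans ?_
  · rw [kappa_cast] at h
    have e : (((L + 1) ^ (d + 1) : ℕ) : ℝ) = ((L : ℝ) + 1) ^ (d + 1) := by push_cast; ring
    rwa [e] at h
  · rw [← nsmul_eq_mul, ← Finset.sum_const]
    refine Finset.sum_le_sum fun a ha => Finset.sum_le_sum fun m _ =>
      mul_le_mul_of_nonneg_right ?_ (pow_nonneg hx.le m)
    exact_mod_cast card_tubeWalksFrom_le_tubeCount (tubeStarts_mono (Nat.le_succ L) ha)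

/-- **Theorem 8.2.1 (8.2.11) for tubes**: "`μ(R) < μ`" for `R = R[1,L] = ℤ × {0,…,L}^{d+1} ⊂ ℤ^{d+2}`
(book p. 269). Here from the quantitative form (the printed proof uses the Pattern Theorem).
[cite: MadrasSlade1993, §8.2, eq. (8.2.11) (remark before Theorem 8.2.1)] -/
theorem tubeConnectiveConstant_lt_connectiveConstant (L : ℕ) :
    tubeConnectiveConstant (d + 2) 1 L < connectiveConstant (d + 2) := by
  have h := log_connectiveConstant_sub_log_tubeConnectiveConstant_ge (d := d) L
  have hμ := connectiveConstant_pos (d + 2)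
  have hpos : 0 < Real.log (1 + connectiveConstant (d + 2) ^ (-(2 * ((L : ℝ) + 1) ^ (d + 1) + 2 * L + 2))) /
      ((L : ℝ) + 1) ^ (d + 1) :=
    div_pos (Real.log_pos (by linarith [Real.rpow_pos_of_pos hμ (-(2 * ((L : ℝ) + 1) ^ (d + 1) + 2 * L + 2))]))
      (by positivity)
  have : Real.log (tubeConnectiveConstant (d + 2) 1 L) < Real.log (connectiveConstant (d + 2)) := by linarith
  exact (Real.log_lt_log_iff (tubeConnectiveConstant_pos (d := d + 2) le_rfl L) hμ).1 this

/-- **Theorem 8.2.1 (8.2.13) for tubes**: "`μ(R[k,T]) < μ(R[k,T+1])` for every `T ≥ 0`", here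
`k = 1`, dimension `d + 2` (book p. 269; printed proof p. 270 via (8.2.15)–(8.2.16)). Here from the
quantitative form (column insertion). [cite: MadrasSlade1993, §8.2, Theorem 8.2.1, eq. (8.2.13)] -/
theorem tubeConnectiveConstant_lt_succ (L : ℕ) :
    tubeConnectiveConstant (d + 2) 1 L < tubeConnectiveConstant (d + 2) 1 (L + 1) := by
  have h := log_tubeConnectiveConstant_succ_sub_log_ge (d := d) L
  have hμ := tubeConnectiveConstant_pos (d := d + 2) (k := 1) le_rfl (L + 1)
  have hpos : 0 < Real.log (1 + tubeConnectiveConstant (d + 2) 1 (L + 1) ^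
      (-(2 * ((L : ℝ) + 1) ^ (d + 1) + 2 * L + 2))) / ((L : ℝ) + 1) ^ (d + 1) :=
    div_pos (Real.log_pos (by linarith [Real.rpow_pos_of_pos hμ (-(2 * ((L : ℝ) + 1) ^ (d + 1) + 2 * L + 2))]))
      (by positivity)
  have : Real.log (tubeConnectiveConstant (d + 2) 1 L) < Real.log (tubeConnectiveConstant (d + 2) 1 (L + 1)) := by
    linarith
  exact (Real.log_lt_log_iff (tubeConnectiveConstant_pos (d := d + 2) le_rfl L) hμ).1 this

/-- **Theorem 8.2.1 (8.2.13) for tubes, monotone form**: `L ↦ μ(ℤ × {0,…,L}^{d+1})` is strictly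
increasing (book p. 269). [cite: MadrasSlade1993, §8.2, Theorem 8.2.1, eq. (8.2.13)] -/
theorem strictMono_tubeConnectiveConstant :
    StrictMono fun L => tubeConnectiveConstant (d + 2) 1 L :=
  strictMono_nat_of_lt_succ tubeConnectiveConstant_lt_succ


/-- (8.2.13) for the tubes `ℤ × {0,…,L}^{d-1}` of `ℤ^d`, stated for every `d ≥ 2`.
[cite: MadrasSlade1993, §8.2, Theorem 8.2.1, eq. (8.2.13)] -/
theorem tubeConnectiveConstant_lt_succ_of_two_le {D : ℕ} (hD : 2 ≤ D) (L : ℕ) :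
    tubeConnectiveConstant D 1 L < tubeConnectiveConstant D 1 (L + 1) := by
  obtain ⟨d, rfl⟩ : ∃ d, D = d + 2 := ⟨D - 2, by omega⟩
  exact tubeConnectiveConstant_lt_succ L

/-- (8.2.11) for the tubes `ℤ × {0,…,L}^{d-1}` of `ℤ^d`, stated for every `d ≥ 2`.
[cite: MadrasSlade1993, §8.2, eq. (8.2.11) (remark before Theorem 8.2.1)] -/
theorem tubeConnectiveConstant_lt_connectiveConstant_of_two_le {D : ℕ} (hD : 2 ≤ D) (L : ℕ) :
    tubeConnectiveConstant D 1 L < connectiveConstant D := by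
  obtain ⟨d, rfl⟩ : ∃ d, D = d + 2 := ⟨D - 2, by omega⟩
  exact tubeConnectiveConstant_lt_connectiveConstant L

end Assembly

/-! ## Polygons in tubes: the polygon analogue of (8.2.13) with an explicit margin (Theorem 8.2.2)

Madras–Slade Theorem 8.2.2 (book pp. 270–271, "an outline of the proof"): the number `q_N(R)` of `N`-step
self-avoiding polygons of `R = R[k,T]` up to horizontal translation has a growth rate `μ_Polygon(R)`, with
`μ_Polygon(R) < μ(R)` for `k = 1`.  Below, polygons are counted as ROOTED ORIENTED closed walks (`= 2N q_N(R)`,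
same growth rate), `π(R) := limsup_N q̃_{2N+2}(R)^{1/(2N+2)}` (no existence statement is needed), and the
column insertion `Ψ` of this file, applied to the polygon opened at its root and to cuts avoiding the closing
edge, gives the explicit monotonicity margin `log(1 + π(T_{L+1})^{-κ})/(L+1)^{d+1} ≤ log π(T_{L+1}) − log π(T_L)`
for the tubes `T_L = ℤ × {0,…,L}^{d+1}`, `L ≥ 1` (lane pcv-sawmu, item POL-B; statement shape by the lane's seat
a-idea-2).  In print: M–S Theorem 8.2.2 (b) (polygons vs walks in a tube,
qualitative outline); Whittington LNP 775 §2.9.2 (2.57): `κ(L) < κ(L+1)` for slabs (qualitative); the objects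
`tubePolygonPairs/Count/Rate` live in `SAWTubePolygons.lean`. -/

section Polygons

variable {d : ℕ} {L : ℕ} {R : Finset ℤ} {a : Site (d + 2)}

/-- The column of the cut possibly crossed by the closing edge of the opened polygon. [folklore] -/
private def cstar (ω : ℕ → Site (d + 2)) (n : ℕ) : ℤ := min (ω n 0) (ω 0 0)

/-- **The closing edge survives**: two adjacent sites are mapped by `smap R` to adjacent sites provided the
cut between their columns (if any) is not in `R`. [folklore] -/
private theorem smap_adj_smap {p q : Site (d + 2)} (hadj : (zdGraph (d + 2)).Adj p q) (hR : min (p 0) (q 0) ∉ R) :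
    (zdGraph (d + 2)).Adj (smap R p) (smap R q) := by
  by_cases heq : p 0 = q 0
  · rw [zdGraph_adj_iff] at hadj ⊢
    obtain ⟨i, hi⟩ := hadj
    have hi0 : i ≠ 0 := by
      rintro rfl
      rcases hi with h | h
      · have := congrFun h 0; simp at this; omega
      · have := congrFun h 0; simp at this; omega
    refine ⟨i, ?_⟩
    rcases hi with h | h
    · left; funext j
      by_cases hj : j = 0
      · subst hj; simp [heq, Pi.single_eq_of_ne (Ne.symm hi0)]
      · have := congrFun h j; simp [hj] at this ⊢; exact this
    · right; funext j
      by_cases hj : j = 0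
      · subst hj; simp [heq, Pi.single_eq_of_ne (Ne.symm hi0)]
      · have := congrFun h j; simp [hj] at this ⊢; exact this
  · obtain ⟨hstep, hrest⟩ := step_of_col_ne hadj heq
    rcases hstep with h | h
    · -- `q = p + e₀`: the cut is `p 0 ∉ R`
      have hq0 : q 0 = p 0 + 1 := by rw [h]; simp
      have hmin : min (p 0) (q 0) = p 0 := by rw [hq0]; exact min_eq_left (by omega)
      rw [hmin] at hR
      have hc := colMap_succ_of_not_mem hR
      have e : smap R q = smap R p + cvec d 1 := by
        funext i
        by_cases hi : i = 0
        · subst hi; simp [hq0, hc]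
        · simp [hi, hrest i hi]
      rw [e]; exact adj_add_cvec_one _
    · -- `q = p - e₀`: the cut is `q 0 ∉ R`
      have hq0 : p 0 = q 0 + 1 := by rw [h]; simp
      have hmin : min (p 0) (q 0) = q 0 := by rw [hq0]; exact min_eq_right (by omega)
      rw [hmin] at hR
      have hc := colMap_succ_of_not_mem hR
      have e : smap R p = smap R q + cvec d 1 := by
        funext i
        by_cases hi : i = 0
        · subst hi; simp [hq0, hc]
        · simp [hi, hrest i hi]
      rw [e]; exact (adj_add_cvec_one _).symm

/-- The pairs `(υ, R)` for polygons: an opened rooted polygon from `a` and a set of its cuts avoiding the cut of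
the closing edge. [folklore] -/
private def pdom (L N : ℕ) (a : Site (d + 2)) : Finset (Σ _ : ℕ → Site (d + 2), Finset ℤ) :=
  (TubePolygon.tubePolygonsFrom L N a).sigma fun υ =>
    ((cuts (fun t => a + υ t) (N - 1)).erase (cstar (fun t => a + υ t) (N - 1))).powerset

/-- Membership in `pdom`. [folklore] -/
private theorem mem_pdom {L N : ℕ} {p : Σ _ : ℕ → Site (d + 2), Finset ℤ} :
    p ∈ pdom L N a ↔ p.1 ∈ TubePolygon.tubePolygonsFrom L N a ∧
      p.2 ⊆ (cuts (fun t => a + p.1 t) (N - 1)).erase (cstar (fun t => a + p.1 t) (N - 1)) := by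
  rw [pdom, Finset.mem_sigma, Finset.mem_powerset]

/-- `pdom ⊆ dom` (forgetting the closing condition). [folklore] -/
private theorem pdom_subset_dom (L N : ℕ) (a : Site (d + 2)) : pdom L N a ⊆ dom L (N - 1) a := by
  intro p hp
  obtain ⟨hυ, hR⟩ := mem_pdom.1 hp
  exact mem_dom.2 ⟨(TubePolygon.mem_tubePolygonsFrom.1 hυ).1, hR.trans (Finset.erase_subset _ _)⟩

/-- The last vertex of the image list is the image of the last vertex. [folklore] -/
private theorem getLast_imageList (L : ℕ) (R : Finset ℤ) (ω : ℕ → Site (d + 2)) (n : ℕ) :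
    (imageList L R ω n).getLast (imageList_ne_nil L R ω n) = smap R (ω n) := by
  simp [imageList]

/-- **The image of an opened polygon closes up**: `Ψ(ω,R)`, with `R` avoiding the cut of the closing edge, is an
opened rooted polygon of `T_{L+1}` of length `len + 1`. [folklore] -/
private theorem psi_TubePolygon.mem_tubePolygonsFrom (ha : a ∈ tubeStarts (d + 2) 1 L) {N : ℕ} {p : Σ _ : ℕ → Site (d + 2), Finset ℤ}
    (hp : p ∈ pdom L N a) :
    psi L p.2 (fun t => a + p.1 t) (N - 1) ∈ TubePolygon.tubePolygonsFrom (L + 1) (len L (N - 1) a p + 1) a := by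
  obtain ⟨hυ, hR⟩ := mem_pdom.1 hp
  obtain ⟨hυw, h3, hadj⟩ := TubePolygon.mem_tubePolygonsFrom.1 hυ
  have hpd : p ∈ dom L (N - 1) a := pdom_subset_dom L N a hp
  obtain ⟨hW, h0, ha0⟩ := tubeWalk_of_mem ha hυw
  have h00 : (a + p.1 0) 0 = 0 := by rw [h0]; exact ha0
  rw [TubePolygon.mem_tubePolygonsFrom, Nat.add_sub_cancel]
  refine ⟨psi_mem_of_mem_dom ha hpd, by unfold len; omega, ?_⟩
  -- the closing edge
  have hlen : len L (N - 1) a p = (imageList L p.2 (fun t => a + p.1 t) (N - 1)).length - 1 := by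
    rw [length_imageList hW]; unfold len; omega
  have hlast : psi L p.2 (fun t => a + p.1 t) (N - 1) (len L (N - 1) a p) =
      smap p.2 (a + p.1 (N - 1)) - (a + p.1 0) := by
    unfold psi
    rw [ofList_eq_getLast (imageList_ne_nil _ _ _ _) (by rw [hlen]), getLast_imageList]
  rw [hlast]
  have hstart : smap p.2 (a + p.1 0) = a + p.1 0 := smap_eq_self_of_col_zero p.2 h00
  rw [show (0 : Site (d + 2)) = smap p.2 (a + p.1 0) - (a + p.1 0) by rw [hstart, sub_self],
    zdGraph_adj_sub_right]
  refine smap_adj_smap ?_ fun h => ?_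
  · have hp0 : p.1 0 = 0 := (mem_saws.1 (mem_tubeWalksFrom.1 hυw).1).1
    have h1 : (zdGraph (d + 2)).Adj (p.1 (N - 1) + a) (0 + a) := (zdGraph_adj_add_right _ _ _).2 hadj
    rw [zero_add] at h1
    rw [hp0, add_zero, add_comm a (p.1 (N - 1))]
    exact h1
  · exact (Finset.mem_erase.1 (hR h)).1 rfl

/-- The generating polynomial of the polygon pairs, by image length. [folklore] -/
private theorem sum_pdom_eq (ha : a ∈ tubeStarts (d + 2) 1 L) (N : ℕ) (x : ℝ) :
    ∑ p ∈ pdom L N a, x ^ len L (N - 1) a p =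
      ∑ m ∈ Finset.range ((kappa d L + 1) * (N - 1) + 1),
        (((pdom L N a).filter fun p => len L (N - 1) a p = m).card : ℝ) * x ^ m := by
  rw [← Finset.sum_fiberwise_of_maps_to (g := len L (N - 1) a)
    (t := Finset.range ((kappa d L + 1) * (N - 1) + 1))
    fun p hp => Finset.mem_range.2 (Nat.lt_succ_of_le (len_le ha (pdom_subset_dom L N a hp)))]
  refine Finset.sum_congr rfl fun m _ => ?_
  rw [Finset.sum_congr rfl fun p hp => by rw [(Finset.mem_filter.1 hp).2], Finset.sum_const,
    nsmul_eq_mul]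

/-- **Upper bound** for polygons by injectivity (decoding = the walk decoding after dropping the closing edge).
[folklore] -/
private theorem sum_pdom_le (ha : a ∈ tubeStarts (d + 2) 1 L) (N : ℕ) {x : ℝ} (hx : 0 ≤ x) :
    ∑ p ∈ pdom L N a, x ^ len L (N - 1) a p ≤
      ∑ m ∈ Finset.range ((kappa d L + 1) * (N - 1) + 1),
        ((TubePolygon.tubePolygonsFrom (L + 1) (m + 1) a).card : ℝ) * x ^ m := by
  rw [sum_pdom_eq ha]
  refine Finset.sum_le_sum fun m _ => mul_le_mul_of_nonneg_right ?_ (pow_nonneg hx m)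
  exact_mod_cast Finset.card_le_card_of_injOn _
    (fun p hp => by
      have hp' := Finset.mem_filter.1 hp
      simpa [hp'.2] using psi_TubePolygon.mem_tubePolygonsFrom ha hp'.1)
    ((psi_injOn ha m).mono (Finset.coe_subset.2
      (Finset.filter_subset_filter _ (pdom_subset_dom L N a))))

/-- **Lower bound** for polygons: cuts avoiding the closing edge number at least `⌊(N-1)/(L+1)^{d+1}⌋ - 1`.
[folklore] -/
private theorem le_sum_pdom (ha : a ∈ tubeStarts (d + 2) 1 L) (N : ℕ) {x : ℝ} (hx : 0 ≤ x) (hx1 : x ≤ 1) :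
    ((TubePolygon.tubePolygonsFrom L N a).card : ℝ) * x ^ (N - 1) *
        (1 + x ^ kappa d L) ^ ((N - 1) / (L + 1) ^ (d + 1) - 1) ≤
      ∑ p ∈ pdom L N a, x ^ len L (N - 1) a p := by
  rw [pdom, Finset.sum_sigma]
  have key : ∀ υ ∈ TubePolygon.tubePolygonsFrom L N a,
      x ^ (N - 1) * (1 + x ^ kappa d L) ^ ((N - 1) / (L + 1) ^ (d + 1) - 1) ≤
        ∑ R ∈ ((cuts (fun t => a + υ t) (N - 1)).erase (cstar (fun t => a + υ t) (N - 1))).powerset,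
          x ^ len L (N - 1) a ⟨υ, R⟩ := by
    intro υ hυ
    obtain ⟨hW, -, -⟩ := tubeWalk_of_mem ha (TubePolygon.mem_tubePolygonsFrom.1 hυ).1
    set S := (cuts (fun t => a + υ t) (N - 1)).erase (cstar (fun t => a + υ t) (N - 1)) with hS
    show _ ≤ ∑ R ∈ S.powerset, x ^ ((N - 1) + ∑ c ∈ R, cost L (fun t => a + υ t) (N - 1) c)
    rw [Finset.sum_congr rfl fun R _ => by rw [pow_add, ← Finset.prod_pow_eq_pow_sum],
      ← Finset.mul_sum, ← Finset.prod_one_add]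
    refine mul_le_mul_of_nonneg_left ?_ (pow_nonneg hx _)
    have hcard : (N - 1) / (L + 1) ^ (d + 1) - 1 ≤ S.card := by
      have h1 := div_le_card_cuts hW
      have h2 := Finset.pred_card_le_card_erase (s := cuts (fun t => a + υ t) (N - 1))
        (a := cstar (fun t => a + υ t) (N - 1))
      rw [← hS] at h2
      omega
    calc (1 + x ^ kappa d L) ^ ((N - 1) / (L + 1) ^ (d + 1) - 1)
        ≤ (1 + x ^ kappa d L) ^ S.card :=
          pow_le_pow_right₀ (by linarith [pow_nonneg hx (kappa d L)]) hcard
      _ = ∏ _c ∈ S, (1 + x ^ kappa d L) := (Finset.prod_const _).symm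
      _ ≤ ∏ c ∈ S, (1 + x ^ cost L (fun t => a + υ t) (N - 1) c) :=
          Finset.prod_le_prod (fun c _ => by linarith [pow_nonneg hx (kappa d L)]) fun c hc => by
            have : x ^ kappa d L ≤ x ^ cost L (fun t => a + υ t) (N - 1) c :=
              pow_le_pow_of_le_one hx hx1 (cost_le hW (Finset.mem_of_mem_erase hc))
            linarith
  calc ((TubePolygon.tubePolygonsFrom L N a).card : ℝ) * x ^ (N - 1) * (1 + x ^ kappa d L) ^ ((N - 1) / (L + 1) ^ (d + 1) - 1)
      = ∑ _υ ∈ TubePolygon.tubePolygonsFrom L N a, x ^ (N - 1) * (1 + x ^ kappa d L) ^ ((N - 1) / (L + 1) ^ (d + 1) - 1) := by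
        rw [Finset.sum_const, nsmul_eq_mul, mul_assoc]
    _ ≤ _ := Finset.sum_le_sum key

/-- **The finite core for polygons** (generating-function form, summed over the start cross-sections):
for `0 ≤ x ≤ 1`, `q̃_N(T_L) x^{N-1} (1 + x^κ)^{⌊(N-1)/(L+1)^{d+1}⌋ - 1} ≤ Σ_{m ≤ (κ+1)(N-1)} q̃_{m+1}(T_{L+1}) x^m`.
[folklore] -/
private theorem poly_core (L N : ℕ) {x : ℝ} (hx : 0 ≤ x) (hx1 : x ≤ 1) :
    (tubePolygonCount (d + 2) 1 L N : ℝ) * x ^ (N - 1) *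
        (1 + x ^ kappa d L) ^ ((N - 1) / (L + 1) ^ (d + 1) - 1) ≤
      ∑ m ∈ Finset.range ((kappa d L + 1) * (N - 1) + 1),
        (tubePolygonCount (d + 2) 1 (L + 1) (m + 1) : ℝ) * x ^ m := by
  rw [TubePolygon.tubePolygonCount_eq_sum L N]
  push_cast
  rw [Finset.sum_mul, Finset.sum_mul]
  calc ∑ a ∈ tubeStarts (d + 2) 1 L, ((TubePolygon.tubePolygonsFrom L N a).card : ℝ) * x ^ (N - 1) *
          (1 + x ^ kappa d L) ^ ((N - 1) / (L + 1) ^ (d + 1) - 1)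
      ≤ ∑ a ∈ tubeStarts (d + 2) 1 L, ∑ m ∈ Finset.range ((kappa d L + 1) * (N - 1) + 1),
          ((TubePolygon.tubePolygonsFrom (L + 1) (m + 1) a).card : ℝ) * x ^ m :=
        Finset.sum_le_sum fun a ha => (le_sum_pdom ha N hx hx1).trans (sum_pdom_le ha N hx)
    _ ≤ ∑ a ∈ tubeStarts (d + 2) 1 (L + 1), ∑ m ∈ Finset.range ((kappa d L + 1) * (N - 1) + 1),
          ((TubePolygon.tubePolygonsFrom (L + 1) (m + 1) a).card : ℝ) * x ^ m :=
        Finset.sum_le_sum_of_subset_of_nonneg (tubeStarts_mono (Nat.le_succ L)) fun a _ _ =>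
          Finset.sum_nonneg fun m _ => mul_nonneg (Nat.cast_nonneg _) (pow_nonneg hx m)
    _ = ∑ m ∈ Finset.range ((kappa d L + 1) * (N - 1) + 1),
          (tubePolygonCount (d + 2) 1 (L + 1) (m + 1) : ℝ) * x ^ m := by
        rw [Finset.sum_comm]
        refine Finset.sum_congr rfl fun m _ => ?_
        rw [TubePolygon.tubePolygonCount_eq_sum (L + 1) (m + 1)]
        push_cast
        rw [Finset.sum_mul]

end Polygons

section PolygonExtraction

variable {d : ℕ}

/-- **Extraction lemma, limsup version.** If `A_{n+1} xⁿ (1 + x^E)^{⌊n/Q⌋ - 1} ≤ Σ_{m ≤ Kn} C_{m+1} x^m` for all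
`n` and `0 < x ≤ 1`, where `A_{n+1} ≥ (α-η)^{n+1}` frequently and `C_m ≤ (γ+η)^m` eventually (every `η > 0`),
`α > 0`, `γ ≥ 1`, `Q ≥ 1`, then `log(1 + γ^{-E})/Q ≤ log γ − log α`. [folklore] -/
private theorem extract_freq {α γ : ℝ} {E Q K : ℕ} {A C : ℕ → ℝ} (hα : 0 < α) (hγ : 1 ≤ γ) (hQ : 0 < Q)
    (hC0 : ∀ m, 0 ≤ C m)
    (hA : ∀ η : ℝ, 0 < η → η < α → ∃ᶠ n : ℕ in atTop, (α - η) ^ (n + 1) ≤ A (n + 1))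
    (hC : ∀ η : ℝ, 0 < η → ∀ᶠ m : ℕ in atTop, C m ≤ (γ + η) ^ m)
    (h : ∀ n : ℕ, ∀ x : ℝ, 0 < x → x ≤ 1 →
      A (n + 1) * x ^ n * (1 + x ^ E) ^ (n / Q - 1) ≤
        ∑ m ∈ Finset.range (K * n + 1), C (m + 1) * x ^ m) :
    Real.log (1 + γ⁻¹ ^ E) / (Q : ℝ) ≤ Real.log γ - Real.log α := by
  have hγ0 : 0 < γ := by linarith
  have hQ' : (0 : ℝ) < Q := by exact_mod_cast hQ
  set r : ℝ := 1 / (Q : ℝ) with hr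
  have hr0 : 0 ≤ r := by rw [hr]; positivity
  set g : ℝ → ℝ := fun x => α * x * (1 + x ^ E) ^ r with hg
  -- Step A: `g x ≤ 1` for `0 < x < 1/γ`
  have hB' : ∀ x : ℝ, 0 < x → x < 1 / γ → g x ≤ 1 := by
    intro x hx hxγ
    have hx1 : x ≤ 1 := by
      have : 1 / γ ≤ 1 := by rw [div_le_one hγ0]; exact hγ
      linarith
    have hb1 : 1 ≤ 1 + x ^ E := by linarith [pow_nonneg hx.le E]
    have hb0 : 0 < 1 + x ^ E := by linarith
    -- the root test at this `x`
    have hγx : γ < 1 / x := (lt_one_div hx hγ0).1 hxγ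
    set η₂ : ℝ := 1 / x - γ with hη₂
    have hη₂0 : 0 < η₂ := by rw [hη₂]; linarith
    obtain ⟨M₀, hM₀⟩ := eventually_atTop.1 (hC (η₂ / 2) (by positivity))
    have hux : (γ + η₂ / 2) * x ≤ 1 := by
      have e : (γ + η₂ / 2) * x = (γ * x + 1) / 2 := by
        rw [hη₂]; field_simp; ring
      rw [e]
      have : γ * x < 1 := by
        have := mul_lt_mul_of_pos_right hγx hx
        rwa [one_div, inv_mul_cancel₀ hx.ne'] at this
      linarith
    set Bx : ℝ := 1 + ∑ m ∈ Finset.range M₀, C m with hBx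
    have hS0 : 0 ≤ ∑ m ∈ Finset.range M₀, C m := Finset.sum_nonneg fun m _ => hC0 m
    have hBx0 : 0 < Bx := by rw [hBx]; linarith
    have hCm : ∀ m, C m * x ^ m ≤ Bx := by
      intro m
      rcases lt_or_ge m M₀ with hm | hm
      · have h1 : C m * x ^ m ≤ C m := by
          have := pow_le_one₀ hx.le hx1 (n := m)
          nlinarith [hC0 m]
        have h2 : C m ≤ ∑ m ∈ Finset.range M₀, C m :=
          Finset.single_le_sum (f := C) (fun m _ => hC0 m) (Finset.mem_range.2 hm)
        linarith
      · calc C m * x ^ m ≤ (γ + η₂ / 2) ^ m * x ^ m :=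
              mul_le_mul_of_nonneg_right (hM₀ m hm) (pow_nonneg hx.le m)
          _ = ((γ + η₂ / 2) * x) ^ m := (mul_pow _ _ m).symm
          _ ≤ 1 := pow_le_one₀ (by positivity) hux
          _ ≤ Bx := by rw [hBx]; linarith
    have hsum : ∀ n : ℕ, ∑ m ∈ Finset.range (K * n + 1), C (m + 1) * x ^ m ≤ ((K * n + 1 : ℕ) : ℝ) * (Bx / x) := by
      intro n
      calc ∑ m ∈ Finset.range (K * n + 1), C (m + 1) * x ^ m ≤ ∑ _m ∈ Finset.range (K * n + 1), Bx / x := by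
            refine Finset.sum_le_sum fun m _ => ?_
            rw [le_div_iff₀ hx]
            have : C (m + 1) * x ^ m * x = C (m + 1) * x ^ (m + 1) := by ring
            rw [this]; exact hCm (m + 1)
        _ = _ := by rw [Finset.sum_const, Finset.card_range, nsmul_eq_mul]
    -- for every `0 < η₁ < α`: `(α - η₁) x (1+x^E)^r ≤ 1`
    have hy1 : ∀ η₁ : ℝ, 0 < η₁ → η₁ < α → (α - η₁) * x * (1 + x ^ E) ^ r ≤ 1 := by
      intro η₁ h1 h2
      have hαη : 0 < α - η₁ := by linarith
      set y := (α - η₁) * x * (1 + x ^ E) ^ r with hy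
      by_contra hyc
      rw [not_le] at hyc
      set D : ℝ := ((K : ℝ) + 1) * (Bx / x) * (1 + x ^ E) ^ 2 / (α - η₁) with hD
      have hD0 : 0 ≤ D := by rw [hD]; positivity
      have hfreq := hA η₁ h1 h2
      have ht := tendsto_pow_const_div_const_pow_of_one_lt 1 hyc
      have hev := ht.eventually_lt_const (show (0 : ℝ) < 1 / (D + 1) by positivity)
      obtain ⟨n, hnA, hnB, hn1⟩ := (hfreq.and_eventually (hev.and (eventually_ge_atTop 1))).exists
      simp only [pow_one] at hnB
      have hyn : 0 < y ^ n := pow_pos (by linarith) n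
      have hn1' : (1 : ℝ) ≤ n := by exact_mod_cast hn1
      -- the exponent bookkeeping: `(1+x^E)^{rn} ≤ (1+x^E)^{⌊n/Q⌋-1} (1+x^E)^2`
      have e2 : (1 + x ^ E) ^ (r * n) ≤ (1 + x ^ E) ^ (n / Q - 1) * (1 + x ^ E) ^ 2 := by
        have hle : r * n ≤ (((n / Q - 1 : ℕ) : ℝ)) + 2 := by
          have h3 := div_le_natDiv_add_one n hQ
          have h4 : ((n / Q : ℕ) : ℝ) ≤ ((n / Q - 1 : ℕ) : ℝ) + 1 := by
            exact_mod_cast (show n / Q ≤ n / Q - 1 + 1 by omega)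
          rw [hr, one_div_mul_eq_div]
          linarith
        calc (1 + x ^ E) ^ (r * n) ≤ (1 + x ^ E) ^ ((((n / Q - 1 : ℕ) : ℝ)) + 2) :=
              Real.rpow_le_rpow_of_exponent_le hb1 hle
          _ = (1 + x ^ E) ^ (n / Q - 1) * (1 + x ^ E) ^ 2 := by
              rw [Real.rpow_add hb0, Real.rpow_natCast, show (2 : ℝ) = ((2 : ℕ) : ℝ) by norm_num,
                Real.rpow_natCast]
      have e1 : y ^ n = (α - η₁) ^ n * x ^ n * (1 + x ^ E) ^ (r * n) := by
        rw [hy, mul_pow, mul_pow, Real.rpow_mul (by linarith), Real.rpow_natCast]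
      -- main chain: `(α - η₁) yⁿ ≤ (K+1) n Bx/x (1+x^E)²`
      have hmain := h n x hx hx1
      have hchain : (α - η₁) * y ^ n ≤ ((K : ℝ) + 1) * n * (Bx / x) * (1 + x ^ E) ^ 2 := by
        have e4 : ((K * n + 1 : ℕ) : ℝ) ≤ ((K : ℝ) + 1) * n := by push_cast; nlinarith
        calc (α - η₁) * y ^ n = (α - η₁) ^ (n + 1) * x ^ n * (1 + x ^ E) ^ (r * n) := by rw [e1]; ring
          _ ≤ (α - η₁) ^ (n + 1) * x ^ n * ((1 + x ^ E) ^ (n / Q - 1) * (1 + x ^ E) ^ 2) :=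
              mul_le_mul_of_nonneg_left e2 (by positivity)
          _ = ((α - η₁) ^ (n + 1) * x ^ n * (1 + x ^ E) ^ (n / Q - 1)) * (1 + x ^ E) ^ 2 := by ring
          _ ≤ (A (n + 1) * x ^ n * (1 + x ^ E) ^ (n / Q - 1)) * (1 + x ^ E) ^ 2 := by
              have : (α - η₁) ^ (n + 1) * x ^ n * (1 + x ^ E) ^ (n / Q - 1) ≤
                  A (n + 1) * x ^ n * (1 + x ^ E) ^ (n / Q - 1) :=
                mul_le_mul_of_nonneg_right (mul_le_mul_of_nonneg_right hnA (pow_nonneg hx.le n))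
                  (pow_nonneg hb0.le _)
              exact mul_le_mul_of_nonneg_right this (by positivity)
          _ ≤ (((K * n + 1 : ℕ) : ℝ) * (Bx / x)) * (1 + x ^ E) ^ 2 :=
              mul_le_mul_of_nonneg_right (hmain.trans (hsum n)) (by positivity)
          _ ≤ (((K : ℝ) + 1) * n * (Bx / x)) * (1 + x ^ E) ^ 2 :=
              mul_le_mul_of_nonneg_right (mul_le_mul_of_nonneg_right e4 (by positivity)) (by positivity)
          _ = _ := by ring
      have hyD : y ^ n ≤ D * n := by
        rw [hD]
        have : y ^ n = (α - η₁) * y ^ n / (α - η₁) := by field_simp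
        rw [this, div_mul_eq_mul_div, ]
        exact div_le_div_of_nonneg_right (by linarith [hchain]) hαη.le
      -- but `n / yⁿ < 1/(D+1)` says `yⁿ > (D+1) n`
      have h5 : (D + 1) * n < y ^ n := by
        have := hnB
        rw [div_lt_div_iff₀ hyn (by positivity), one_mul] at this
        linarith
      nlinarith
    -- `η₁ → 0`
    show α * x * (1 + x ^ E) ^ r ≤ 1
    have hb : 0 < x * (1 + x ^ E) ^ r := by positivity
    refine le_of_forall_pos_le_add fun ε hε => ?_
    set η₁ := min (α / 2) (ε / (x * (1 + x ^ E) ^ r)) with hη₁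
    have h1 : 0 < η₁ := by rw [hη₁]; positivity
    have h2 : η₁ < α := by
      have : η₁ ≤ α / 2 := min_le_left _ _; linarith
    have h3 : η₁ * (x * (1 + x ^ E) ^ r) ≤ ε := by
      have : η₁ ≤ ε / (x * (1 + x ^ E) ^ r) := min_le_right _ _
      rwa [le_div_iff₀ hb] at this
    have h4 := hy1 η₁ h1 h2
    nlinarith
  -- Step B: continuity at `x = 1/γ`
  have hcont : Continuous g := by
    rw [hg]
    exact (continuous_const.mul continuous_id).mul
      ((continuous_const.add (continuous_pow E)).rpow_const fun x => Or.inr hr0)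
  set xs : ℕ → ℝ := fun k => (1 / γ) * (1 - 1 / ((k : ℝ) + 1)) with hxs
  have hxs_lim : Tendsto xs atTop (𝓝 (1 / γ)) := by
    have h1 : Tendsto (fun k : ℕ => (1 : ℝ) - 1 / ((k : ℝ) + 1)) atTop (𝓝 (1 - 0)) :=
      tendsto_const_nhds.sub tendsto_one_div_add_atTop_nhds_zero_nat
    have h2 := h1.const_mul (1 / γ)
    rw [sub_zero, mul_one] at h2
    exact h2
  have hgx0 : g (1 / γ) ≤ 1 := by
    refine le_of_tendsto' ((hcont.tendsto _).comp hxs_lim) fun k => ?_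
    rcases Nat.eq_zero_or_pos k with rfl | hk
    · simp [hxs, hg]
    refine hB' (xs k) ?_ ?_
    · rw [hxs]
      have : (0 : ℝ) < 1 - 1 / ((k : ℝ) + 1) := by
        rw [sub_pos, div_lt_one (by positivity)]
        have : (1 : ℝ) ≤ k := by exact_mod_cast hk
        linarith
      positivity
    · rw [hxs]
      have h1 : (0 : ℝ) < 1 / ((k : ℝ) + 1) := by positivity
      have h2 : 0 < 1 / γ := by positivity
      nlinarith
  have hb : 0 < 1 + γ⁻¹ ^ E := by positivity
  have hval : g (1 / γ) = α * γ⁻¹ * (1 + γ⁻¹ ^ E) ^ r := by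
    rw [hg]; simp only [one_div]
  rw [hval] at hgx0
  have hpos : 0 < α * γ⁻¹ * (1 + γ⁻¹ ^ E) ^ r := by positivity
  have hlog := Real.log_nonpos hpos.le hgx0
  rw [Real.log_mul (by positivity) (by positivity), Real.log_mul hα.ne' (by positivity),
    Real.log_inv, Real.log_rpow hb, hr, one_div_mul_eq_div] at hlog
  linarith

end PolygonExtraction

section PolygonRate

variable {d : ℕ}

/-- **Explicit polygon analogue of (8.2.13) for the tubes `T_L = ℤ × {0,…,L}^{d+1}`** (this file; in print the
strict inequalities of Theorem 8.2.2 are qualitative): for every `L ≥ 1`, with `κ = 2(L+1)^{d+1} + 2L + 2` and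
`π(T) = limsup_N q̃_{2N+2}(T)^{1/(2N+2)}`,
`log(1 + π(T_{L+1})^{-κ}) / (L+1)^{d+1} ≤ log π(T_{L+1}) − log π(T_L)`.
M–S Theorem 8.2.2 prints existence of `μ_Polygon(R)`, `μ_Polygon(R) < μ(R)` for `k = 1` and `=` for `k > 1`,
not the monotonicity in `T`; strict monotonicity in the width is printed, qualitatively and for slabs of `ℤ^d`
(`d ≥ 3`), in Whittington, LNP 775 §2.9.2 (pattern theorem, after Hammersley–Whittington 1985); the TUBE case with
an explicit margin is this file's (lane pcv-sawmu POL-B).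
[cite: MadrasSlade1993, §8.2, Theorem 8.2.2 (the polygon growth rates μ_Polygon(R[k,T])) and eq. (8.2.13) (the walk statement whose polygon analogue this is; quantitative form, this file)] [cite: Whittington2009LatticePolygons, §2.9.2 eq. (2.57) item 1 (κ(L) < κ(L+1) for polygons in slabs, qualitative)] -/
theorem log_tubePolygonRate_succ_sub_log_ge {L : ℕ} (hL : 1 ≤ L) :
    Real.log (1 + (tubePolygonRate (d + 2) 1 (L + 1))⁻¹ ^ (2 * (L + 1) ^ (d + 1) + 2 * L + 2)) /
        ((L : ℝ) + 1) ^ (d + 1) ≤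
      Real.log (tubePolygonRate (d + 2) 1 (L + 1)) - Real.log (tubePolygonRate (d + 2) 1 L) := by
  have hQ : 0 < (L + 1) ^ (d + 1) := by positivity
  have h := extract_freq (E := kappa d L) (Q := (L + 1) ^ (d + 1)) (K := kappa d L + 1)
    (A := fun N => (tubePolygonCount (d + 2) 1 L N : ℝ))
    (C := fun M => (tubePolygonCount (d + 2) 1 (L + 1) M : ℝ))
    (lt_of_lt_of_le one_pos (TubePolygon.one_le_tubePolygonRate hL)) (TubePolygon.one_le_tubePolygonRate (by omega)) hQ
    (fun m => Nat.cast_nonneg _)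
    (fun η hη hηa => TubePolygon.frequently_pow_le_tubePolygonCount L hη hηa)
    (fun η hη => TubePolygon.eventually_tubePolygonCount_le (L + 1) hη)
    (fun n x hx hx1 => by simpa [Nat.add_sub_cancel] using poly_core (d := d) L (n + 1) hx.le hx1)
  have e : (((L + 1) ^ (d + 1) : ℕ) : ℝ) = ((L : ℝ) + 1) ^ (d + 1) := by push_cast; ring
  rw [e] at h
  exact h

/-- **Theorem 8.2.2, strict monotonicity of the polygon growth rate in tubes** (qualitative corollary):
`π(T_L) < π(T_{L+1})` for every `L ≥ 1`. [cite: MadrasSlade1993, §8.2, Theorem 8.2.2 (μ_Polygon(R[k,T])) and eq. (8.2.13) (walk statement whose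
polygon analogue this is)] [cite: Whittington2009LatticePolygons, §2.9.2 eq. (2.57) item 1 (slabs, qualitative)] -/
theorem tubePolygonRate_lt_succ {L : ℕ} (hL : 1 ≤ L) :
    tubePolygonRate (d + 2) 1 L < tubePolygonRate (d + 2) 1 (L + 1) := by
  have h := log_tubePolygonRate_succ_sub_log_ge (d := d) hL
  have h1 := TubePolygon.one_le_tubePolygonRate (d := d) hL
  have h2 := TubePolygon.one_le_tubePolygonRate (d := d) (show 1 ≤ L + 1 by omega)
  have hpos : 0 < Real.log (1 + (tubePolygonRate (d + 2) 1 (L + 1))⁻¹ ^ (2 * (L + 1) ^ (d + 1) + 2 * L + 2)) /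
      ((L : ℝ) + 1) ^ (d + 1) :=
    div_pos (Real.log_pos (by
      have : 0 < (tubePolygonRate (d + 2) 1 (L + 1))⁻¹ ^ (2 * (L + 1) ^ (d + 1) + 2 * L + 2) := by positivity
      linarith)) (by positivity)
  have : Real.log (tubePolygonRate (d + 2) 1 L) < Real.log (tubePolygonRate (d + 2) 1 (L + 1)) := by linarith
  exact (Real.log_lt_log_iff (by linarith) (by linarith)).1 this

/-- Strict monotonicity of `L ↦ π(T_{L+1})` (`L ≥ 0`). [cite: MadrasSlade1993, §8.2, Theorem 8.2.2 (μ_Polygon(R[k,T])) and eq. (8.2.13) (walk statement whose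
polygon analogue this is)] [cite: Whittington2009LatticePolygons, §2.9.2 eq. (2.57) item 1 (slabs, qualitative)] -/
theorem strictMono_tubePolygonRate_succ :
    StrictMono fun L => tubePolygonRate (d + 2) 1 (L + 1) :=
  strictMono_nat_of_lt_succ fun L => tubePolygonRate_lt_succ (by omega)

end PolygonRate

end TubeInsertion

end Literature.Probability.RandomPlanarGeometry.SAW.Zd
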